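import Literature.Barriers.AnomalousDissipation.ShearFlowViscositySelectionPerturbed
import Literature.Barriers.AnomalousDissipation.ShearFlowViscositySelectionHeat
import Literature.Analysis.FluidPDE.NSStability2HalfD
import HarnessLib

/-!
# Bardos–Titi–Wiedemann 2012, Thm. 5 under data perturbation at the Kelvin–Helmholtz scale:
the vortex-sheet modulus `exp(-c√(T/ν))` (barrier audit, gen 4, of
`ShearFlowViscositySelectionSteps` / `ShearFlowViscositySelectionPerturbed`)

Companion to `Literature/Barriers/AnomalousDissipation/ShearFlowViscositySelectionPerturbed.lean`.
There the perturbed-data reach of the selection theorem of Bardos–Titi–Wiedemann, C. R. Math. 350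
(2012), Thm. 5, is the torus form of Bardos–Lopes Filho–Niu–Nussenzveig Lopes–Titi, SIAM J. Math.
Anal. 45 (2013), Thm. 3.1 / Thm. 4.4: Leray–Hopf families with data `u₀ʲ` select the shear flow as
soon as `‖u₀ʲ - v₀‖₂² exp(ν_jT + 162C²‖v₀‖₂²/ν_j²) → 0` — a modulus `exp(-c/ν²)` coming from the
`L²`-in-time enstrophy budget `∫‖∇U‖₂² ≤ ‖v₀‖₂²/(2ν)` of an *energy-class* reference solution, the
only budget available for general `x₃`-independent `L²` data. Its barrier block recorded "both the
improvement of the modulus and a rigorous non-selection result above it are open".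

The first half of that sentence is settled here for the data of block (i) of the barrier —
Székelyhidi's vortex sheet and, more generally, shear profiles whose Fourier coefficients are
`O(1/|k₂|)` (every profile of bounded variation): the modulus improves to the Kelvin–Helmholtz
scale `exp(-4M√(πT/ν))`, `M = sup_{k₂}|k₂||v̂₁(k₂)|`. The mechanism is elementary and, as far as
searched, unprinted in this form: the reference solution `U = (e^{νt∂₂²}v₁, 0, 0)` is Lipschitz for
`t > 0` with `‖∂₂U(t)‖_∞ ≲ M/√(νt) ∈ L¹(0,T)`, so Serrin's relative energy inequality closes by
Grönwall with exponent `∫₀ᵀ‖∇U‖_∞ ~ M√(T/ν)` — exactly the integrated linear Kelvin–Helmholtz growth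
rate `∫₀ᵀ dt/√(νt)` of the diffusing layer of width `√(νt)`, so that Grönwall-type selection
cannot reach further and non-selection (if any) lives at perturbations `exp(-o(√(T/ν)))`, in
particular algebraic ones (the regime of the computations of Thalabard–Bec–Mailybaev 2020).

## Results (all proved; axioms `propext`, `Classical.choice`, `Quot.sound`)

* `enorm_integral_inner_convect_truncate_le_of_budget` — the truncated trilinear term under an
  `ℓ¹`-Lipschitz budget `∑_k 2π|k|₁‖V̂(k)‖ ≤ β`: `|∫⟪w̃,(w̃·∇)P_N V⟫| ≤ β∫|v - V|²`.
* `lintegral_enorm_sub_sq_add_le_of_budget`, `lintegral_enorm_sub_sq_le_mul_exp_of_budget` —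
  Serrin's difference inequality and its Grönwall form for a Leray–Hopf perturbation `u` of an
  `x₃`-independent Leray–Hopf solution `U` with budget `b ∈ L¹(0,T)`:
  `∫|u(t)-U(t)|² ≤ ∫|u₀-U₀|² exp(2∫₀ᵗ b)` (the truncated cross identity and limit `N → ∞` of
  `FluidPDE/NSUniqueness2HalfD`, with the pointwise bound in place of the sliced Ladyzhenskaya
  inequality; no positivity of `ν` is used).
* `shearField_third_ae_eq_zero` — for the datum `(v₁(x₂),0,0)` the shear-form Leray–Hopf solution
  `(a, 0, c)` of `ShearFlowViscositySelectionStepsProofs` has `c ≡ 0` (the heat part saturates the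
  energy inequality).
* `sum_budget_shearHeat_le`, `lintegral_budget_eq` — its budget is `M√(π/(νs))`, with
  `∫₀ᵗ M√(π/(νs)) ds = 2M√(πt/ν)` (Gaussian lattice sums `∑_{n≠0} e^{-cn²} ≤ √(π/c)`,
  `sum_exp_neg_mul_sq_ne_zero_le`).
* `BardosTitiWiedemann2012_thm5_perturbedData_sheet` — **the selection theorem with modulus
  `exp(4M√(πT/ν_j))`**.

## References

* C. Bardos, E. S. Titi, E. Wiedemann, C. R. Math. Acad. Sci. Paris 350 (2012) 757–760
  = arXiv:1208.2352, Thm. 5 and its proof, Cor. 2 (`BardosTitiWiedemann2012`).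
* C. Bardos, M. C. Lopes Filho, D. Niu, H. J. Nussenzveig Lopes, E. S. Titi, SIAM J. Math. Anal.
  45 (2013) 1871–1885 = arXiv:1201.2742, Thm. 3.1 (proof), §4, Thm. 4.4 (`BardosEtAl2013`).
* J. Serrin, in *Nonlinear Problems* (Madison 1962), 1963, §4, Thm. 6, (27) (`Serrin1963`).
* J. C. Robinson, J. L. Rodrigo, W. Sadowski, *The three-dimensional Navier–Stokes equations*
  (CUP 2016), Lemma A.25 (`RobinsonRodrigoSadowski2016`).
* S. Thalabard, J. Bec, A. A. Mailybaev, Commun. Phys. 3 (2020) 122 (`ThalabardBecMailybaev2020`).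
-/

open MeasureTheory Set Filter Topology UnitAddTorus Function
open scoped ENNReal NNReal InnerProductSpace

noncomputable section

namespace Literature.Barriers.AnomalousDissipation

open Literature.Analysis.FluidPDE Literature.Analysis.FunctionSpaces Literature.Analysis.FunctionSpaces.Torus

/-! ## Serrin's difference inequality under an `ℓ¹`-Lipschitz budget -/

/-- **Lipschitz budget of a truncation, pointwise.** For `V ∈ L¹(T³)` whose Fourier
coefficients have `∑_{k ∈ F} 2π(∑ᵢ|kᵢ|)‖V̂(k)‖ ≤ β` for every finite `F`, the truncation
`P_N V` satisfies `∑ᵢ ‖∂ᵢ P_N V (x)‖ ≤ β` at every point. [folklore] -/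
theorem sum_norm_partialDeriv_fourierTruncate_le {V : UnitAddTorus (Fin 3) → EuclideanSpace ℝ (Fin 3)}
    {β : ℝ} (hβ : ∀ F : Finset (Fin 3 → ℤ), ∑ k ∈ F, (2 * Real.pi * ∑ i, |(k i : ℝ)|) *
      ‖mFourierCoeff (EuclideanSpace.complexify ∘ V) k‖ ≤ β) (N : ℕ) (x : UnitAddTorus (Fin 3)) :
    ∑ i, ‖partialDeriv i (fourierTruncate N V) x‖ ≤ β := by
  rw [fourierTruncate_eq]
  calc ∑ i, ‖partialDeriv i (realTrigPoly (freqBall N) fun k => mFourierCoeff (EuclideanSpace.complexify ∘ V) k) x‖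
      ≤ ∑ i, ∑ k ∈ freqBall N, 2 * Real.pi * |(k i : ℝ)| * ‖mFourierCoeff (EuclideanSpace.complexify ∘ V) k‖ :=
        Finset.sum_le_sum fun i _ => norm_partialDeriv_realTrigPoly_le _ _ i x
    _ = ∑ k ∈ freqBall N, (2 * Real.pi * ∑ i, |(k i : ℝ)|) * ‖mFourierCoeff (EuclideanSpace.complexify ∘ V) k‖ := by
        rw [Finset.sum_comm]
        refine Finset.sum_congr rfl fun k _ => ?_
        rw [Finset.mul_sum, Finset.sum_mul]
    _ ≤ β := hβ _

/-- **The truncated trilinear term under a Lipschitz budget, one slice.** For `v, V ∈ L²(T³)`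
with `∑_{k ∈ F} 2π(∑ᵢ|kᵢ|)‖V̂(k)‖ ≤ β` for all finite `F`, and `w̃ = P_N v - P_N V`:
`|∫⟪w̃, (w̃·∇)P_N V⟫| ≤ β ∫‖v - V‖²` (pointwise `|⟪w̃,(w̃·∇)P_N V⟫| ≤ β|w̃|²` and Bessel for the
truncation of `v - V`). [folklore] -/
theorem enorm_integral_inner_convect_truncate_le_of_budget {v V : UnitAddTorus (Fin 3) → EuclideanSpace ℝ (Fin 3)}
    (hv : MemLp v 2 volume) (hV : MemLp V 2 volume) {β : ℝ}
    (hβ : ∀ F : Finset (Fin 3 → ℤ), ∑ k ∈ F, (2 * Real.pi * ∑ i, |(k i : ℝ)|) *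
      ‖mFourierCoeff (EuclideanSpace.complexify ∘ V) k‖ ≤ β) (N : ℕ) :
    ‖∫ x, ⟪fourierTruncate N v x - fourierTruncate N V x,
        convect (fun y => fourierTruncate N v y - fourierTruncate N V y) (fourierTruncate N V) x⟫_ℝ‖ₑ ≤
      ENNReal.ofReal β * ∫⁻ x, ‖v x - V x‖ₑ ^ 2 := by
  have hβ0 : 0 ≤ β := by simpa using hβ ∅
  have hvi : Integrable v volume := hv.integrable one_le_two
  have hVi : Integrable V volume := hV.integrable one_le_two
  set W : UnitAddTorus (Fin 3) → EuclideanSpace ℝ (Fin 3) := fun y => fourierTruncate N v y - fourierTruncate N V y with hWdef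
  have hWeq : W = fourierTruncate N (v - V) := (Torus.fourierTruncate_sub hvi hVi N).symm
  have hA : IsContDiff 1 (fourierTruncate N V) := (isSmooth_fourierTruncate N V).isContDiff (by simp)
  -- pointwise bound
  have hpt : ∀ x, ‖⟪W x, convect W (fourierTruncate N V) x⟫_ℝ‖ₑ ≤ ENNReal.ofReal β * ‖W x‖ₑ ^ 2 := by
    intro x
    have h1 : ‖⟪W x, convect W (fourierTruncate N V) x⟫_ℝ‖ ≤ β * ‖W x‖ ^ 2 := by
      calc ‖⟪W x, convect W (fourierTruncate N V) x⟫_ℝ‖ ≤ ‖W x‖ * ‖convect W (fourierTruncate N V) x‖ :=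
            norm_inner_le_norm _ _
        _ ≤ ‖W x‖ * (‖W x‖ * ∑ i, ‖partialDeriv i (fourierTruncate N V) x‖) :=
            mul_le_mul_of_nonneg_left (norm_convect_le W hA x) (norm_nonneg _)
        _ ≤ ‖W x‖ * (‖W x‖ * β) := by
            gcongr
            exact sum_norm_partialDeriv_fourierTruncate_le hβ N x
        _ = β * ‖W x‖ ^ 2 := by ring
    calc ‖⟪W x, convect W (fourierTruncate N V) x⟫_ℝ‖ₑ = ENNReal.ofReal ‖⟪W x, convect W (fourierTruncate N V) x⟫_ℝ‖ :=
          (ofReal_norm _).symm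
      _ ≤ ENNReal.ofReal (β * ‖W x‖ ^ 2) := ENNReal.ofReal_le_ofReal h1
      _ = ENNReal.ofReal β * ‖W x‖ₑ ^ 2 := by
          rw [ENNReal.ofReal_mul hβ0, ← ofReal_norm, ENNReal.ofReal_pow (norm_nonneg _)]
  calc ‖∫ x, ⟪W x, convect W (fourierTruncate N V) x⟫_ℝ‖ₑ
      ≤ ∫⁻ x, ‖⟪W x, convect W (fourierTruncate N V) x⟫_ℝ‖ₑ := enorm_integral_le_lintegral_enorm _
    _ ≤ ∫⁻ x, ENNReal.ofReal β * ‖W x‖ₑ ^ 2 := lintegral_mono hpt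
    _ = ENNReal.ofReal β * ∫⁻ x, ‖W x‖ₑ ^ 2 := lintegral_const_mul' _ _ ENNReal.ofReal_ne_top
    _ ≤ ENNReal.ofReal β * ∫⁻ x, ‖v x - V x‖ₑ ^ 2 := by
        refine mul_le_mul' le_rfl ?_
        rw [hWeq]
        exact Literature.Analysis.FluidPDE.Torus.lintegral_enorm_sq_fourierTruncate_le (hv.sub hV) N

/-- **The difference energy inequality under a Lipschitz budget.** Let `u`, `U` be Leray–Hopf
weak solutions of the unforced Navier–Stokes equations on `T³ × [0,T)` with viscosity `ν ≥ 0`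
and `L²` data `u₀`, `U₀`, every slice of `U` independent of `x₃`, and suppose the Fourier
coefficients of the slices of `U` carry the `ℓ¹`-Lipschitz budget
`∑_{k ∈ F} 2π(∑ᵢ|kᵢ|)‖Û(k,s)‖ ≤ b(s)` for all finite `F` and all `s ∈ (0,T)` (so that
`‖∇P_N U(s)‖_∞ ≤ b(s)` uniformly in `N`). Then for every `t ∈ (0,T]`, with `w = u - U`,
`∫‖w(t)‖² + 2ν∫₀ᵗ‖∇w‖₂² ≤ ∫‖u₀ - U₀‖² + 2∫₀ᵗ b(s) ∫‖w(s)‖² ds` — Serrin's inequality (27) with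
the trilinear term bounded pointwise, `|∫⟪w̃,(w̃·∇)P_N U⟫| ≤ b ∫|w̃|²`, instead of by the sliced
Ladyzhenskaya inequality of Bardos et al. 2013 (same truncated cross identity and limit `N → ∞`
as `Torus.IsLerayHopfOn.lintegral_enorm_sub_sq_add_le_of_invariant`, whose proof is followed
verbatim). [cite: Serrin1963, §4 Thm. 6 (27)] [cite: BardosEtAl2013, Thm. 3.1 (proof)] -/
theorem lintegral_enorm_sub_sq_add_le_of_budget {T ν : ℝ}
    {u U : ℝ → UnitAddTorus (Fin 3) → EuclideanSpace ℝ (Fin 3)}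
    {u₀ U₀ : UnitAddTorus (Fin 3) → EuclideanSpace ℝ (Fin 3)}
    (hu : Torus.IsLerayHopfOn T ν 0 u₀ u)
    (hU : Torus.IsLerayHopfOn T ν 0 U₀ U) (hν : 0 ≤ ν) (hT : 0 < T) (hu₀ : MemLp u₀ 2 volume)
    (hU₀ : MemLp U₀ 2 volume)
    (hUinv : ∀ (t : ℝ) (s : UnitAddCircle) (x : UnitAddTorus (Fin 3)), U t (x + Pi.single (2 : Fin 3) s) = U t x)
    {b : ℝ → ℝ} (hb : ∀ s ∈ Ioo 0 T, ∀ F : Finset (Fin 3 → ℤ), ∑ k ∈ F, (2 * Real.pi * ∑ i, |(k i : ℝ)|) *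
      ‖mFourierCoeff (EuclideanSpace.complexify ∘ U s) k‖ ≤ b s)
    {t : ℝ} (ht : t ∈ Ioc 0 T) :
    (∫⁻ x, ‖u t x - U t x‖ₑ ^ 2) + 2 * ENNReal.ofReal ν * ∫⁻ s in Ioo 0 t, Torus.eGradNormSq (u s - U s) ≤
      (∫⁻ x, ‖u₀ x - U₀ x‖ₑ ^ 2) + 2 * ∫⁻ s in Ioo 0 t,
        ENNReal.ofReal (b s) * ∫⁻ x, ‖u s x - U s x‖ₑ ^ 2 := by
  set μ : Measure ℝ := volume.restrict (Ioo 0 t) with hμ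
  have htT : t ≤ T := ht.2
  have hsub : Ioo 0 t ⊆ Ioo 0 T := Ioo_subset_Ioo le_rfl htT
  have hsubc : Ioc 0 t ⊆ Ioc 0 T := Ioc_subset_Ioc_right htT
  -- ### the kernel; the trivial case of an infinite kernel integral
  set K : ℝ → ℝ≥0∞ := fun s => ENNReal.ofReal (b s) * ∫⁻ x, ‖u s x - U s x‖ₑ ^ 2 with hK
  by_cases hKtop : ∫⁻ s in Ioo 0 t, K s = ⊤
  · rw [hKtop, ENNReal.mul_top two_ne_zero, add_top]
    exact le_top
  -- ### forces and data
  have hf0m : AEStronglyMeasurable (Torus.stLift (0 : ℝ → UnitAddTorus (Fin 3) → EuclideanSpace ℝ (Fin 3)))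
      (volume.restrict (Ioo 0 T ×ˢ univ)) := aestronglyMeasurable_const (b := (0 : EuclideanSpace ℝ (Fin 3)))
  have hf0 : ∫⁻ s in Ioo 0 T, ∫⁻ x : UnitAddTorus (Fin 3),
      ‖(0 : ℝ → UnitAddTorus (Fin 3) → EuclideanSpace ℝ (Fin 3)) s x‖ₑ ^ 2 < ⊤ := by simp
  -- ### slices
  have hut : MemLp (u t) 2 volume := hu.memLp t ⟨ht.1.le, ht.2⟩
  have hUt : MemLp (U t) 2 volume := hU.memLp t ⟨ht.1.le, ht.2⟩
  -- ### real notation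
  set Gu : ℝ := (∫⁻ s in Ioo 0 t, Torus.eGradNormSq (u s)).toReal with hGu
  set GU : ℝ := (∫⁻ s in Ioo 0 t, Torus.eGradNormSq (U s)).toReal with hGU
  set S : ℕ → ℝ := fun N => ∫ x, ⟪Torus.fourierTruncate N (u t) x, Torus.fourierTruncate N (U t) x⟫_ℝ with hS
  set S₀ : ℕ → ℝ := fun N => ∫ x, ⟪Torus.fourierTruncate N u₀ x, Torus.fourierTruncate N U₀ x⟫_ℝ with hS₀
  set D : ℕ → ℝ → ℝ := fun N s => 4 * Real.pi ^ 2 * ∑ k ∈ Torus.freqBall N, Torus.freqNormSq k *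
    (inner ℂ (mFourierCoeff (EuclideanSpace.complexify ∘ u s) k)
      (mFourierCoeff (EuclideanSpace.complexify ∘ U s) k)).re with hD
  set Dl : ℝ → ℝ := fun s => 4 * Real.pi ^ 2 * ∑' k : Fin 3 → ℤ, Torus.freqNormSq k *
    (inner ℂ (mFourierCoeff (EuclideanSpace.complexify ∘ u s) k)
      (mFourierCoeff (EuclideanSpace.complexify ∘ U s) k)).re with hDl
  set X : ℕ → ℝ → ℝ := fun N s => (∫ x, ⟪u s x, Torus.convect (u s) (Torus.fourierTruncate N (U s)) x⟫_ℝ) +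
    ∫ x, ⟪U s x, Torus.convect (U s) (Torus.fourierTruncate N (u s)) x⟫_ℝ with hX
  set Y : ℕ → ℝ → ℝ := fun N s => ∫ x, ⟪Torus.fourierTruncate N (u s) x - Torus.fourierTruncate N (U s) x,
    Torus.convect (fun y => Torus.fourierTruncate N (u s) y - Torus.fourierTruncate N (U s) y)
      (Torus.fourierTruncate N (U s)) x⟫_ℝ with hY
  -- ### the inputs
  obtain ⟨hDint, hDlint, hDlim⟩ := hu.tendsto_setIntegral_crossSum hU htT
  obtain ⟨hGw_fin, hGw⟩ := hu.toReal_lintegral_eGradNormSq_sub hU htT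
  obtain ⟨hFm, hFfin, hFlim⟩ := hu.tendsto_lintegral_cross_sub_trilinear hU hν hUinv htT
  have hSlim : Tendsto S atTop (𝓝 (∫ x, ⟪u t x, U t x⟫_ℝ)) :=
    Torus.tendsto_integral_inner_fourierTruncate_fourierTruncate hut hUt
  have hS₀lim : Tendsto S₀ atTop (𝓝 (∫ x, ⟪u₀ x, U₀ x⟫_ℝ)) :=
    Torus.tendsto_integral_inner_fourierTruncate_fourierTruncate hu₀ hU₀
  have hEu := hu.integral_norm_sq_add_le_of_zero_force (t := t) ⟨ht.1.le, ht.2⟩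
  have hEU := hU.integral_norm_sq_add_le_of_zero_force (t := t) ⟨ht.1.le, ht.2⟩
  -- ### the cross identity at level `N`, rewritten
  have hcross : ∀ N, IntegrableOn (X N) (Ioo 0 t) ∧
      S N = S₀ N + (∫ s in Ioo 0 t, X N s) - 2 * ν * ∫ s in Ioo 0 t, D N s := by
    intro N
    obtain ⟨hInt, hId⟩ := hu.integral_inner_fourierTruncate_eq_add_setIntegral hU hT hf0m hf0 hf0m hf0 hu₀ hU₀ N ht
    -- the integrand on `(0, t]`
    have hptw : ∀ s ∈ Ioo 0 t,
        (∫ x, (⟪u s x, Torus.convect (u s) (Torus.fourierTruncate N (U s)) x⟫_ℝ +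
          ν * ⟪u s x, Torus.laplacian (Torus.fourierTruncate N (U s)) x⟫_ℝ +
          ⟪(0 : ℝ → UnitAddTorus (Fin 3) → EuclideanSpace ℝ (Fin 3)) s x, Torus.fourierTruncate N (U s) x⟫_ℝ)) +
        ∫ x, (⟪U s x, Torus.convect (U s) (Torus.fourierTruncate N (u s)) x⟫_ℝ +
          ν * ⟪U s x, Torus.laplacian (Torus.fourierTruncate N (u s)) x⟫_ℝ +
          ⟪(0 : ℝ → UnitAddTorus (Fin 3) → EuclideanSpace ℝ (Fin 3)) s x, Torus.fourierTruncate N (u s) x⟫_ℝ) =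
        X N s - 2 * ν * D N s := by
      intro s hs
      have hsT : s ∈ Ioc 0 T := Ioo_subset_Ioc_self (hsub hs)
      have hus : MemLp (u s) 2 volume := hu.memLp s ⟨hsT.1.le, hsT.2⟩
      have hUs : MemLp (U s) 2 volume := hU.memLp s ⟨hsT.1.le, hsT.2⟩
      simp only [Pi.zero_apply, inner_zero_left, add_zero]
      rw [Torus.flux_zero_fourierTruncate_eq ν hus N, Torus.flux_zero_fourierTruncate_eq ν hUs N]
      have hsymm : ∑ k ∈ Torus.freqBall N, Torus.freqNormSq k *
          (inner ℂ (mFourierCoeff (EuclideanSpace.complexify ∘ U s) k) (mFourierCoeff (EuclideanSpace.complexify ∘ u s) k)).re =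
          ∑ k ∈ Torus.freqBall N, Torus.freqNormSq k *
          (inner ℂ (mFourierCoeff (EuclideanSpace.complexify ∘ u s) k) (mFourierCoeff (EuclideanSpace.complexify ∘ U s) k)).re := by
        refine Finset.sum_congr rfl fun k _ => ?_
        rw [← inner_conj_symm, Complex.conj_re]
      rw [hsymm, hX, hD]
      ring
    have hae : ∀ᵐ s ∂μ,
        (∫ x, (⟪u s x, Torus.convect (u s) (Torus.fourierTruncate N (U s)) x⟫_ℝ +
          ν * ⟪u s x, Torus.laplacian (Torus.fourierTruncate N (U s)) x⟫_ℝ +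
          ⟪(0 : ℝ → UnitAddTorus (Fin 3) → EuclideanSpace ℝ (Fin 3)) s x, Torus.fourierTruncate N (U s) x⟫_ℝ)) +
        ∫ x, (⟪U s x, Torus.convect (U s) (Torus.fourierTruncate N (u s)) x⟫_ℝ +
          ν * ⟪U s x, Torus.laplacian (Torus.fourierTruncate N (u s)) x⟫_ℝ +
          ⟪(0 : ℝ → UnitAddTorus (Fin 3) → EuclideanSpace ℝ (Fin 3)) s x, Torus.fourierTruncate N (u s) x⟫_ℝ) =
        X N s - 2 * ν * D N s :=
      (ae_restrict_mem measurableSet_Ioo).mono hptw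
    have hInt' : IntegrableOn (fun s => X N s - 2 * ν * D N s) (Ioo 0 t) :=
      ((integrableOn_Ioc_iff_integrableOn_Ioo).1 hInt).congr hae
    have hDN : IntegrableOn (fun s => 2 * ν * D N s) (Ioo 0 t) := (hDint N).const_mul _
    have hXint : IntegrableOn (X N) (Ioo 0 t) := (hInt'.add hDN).congr (ae_of_all _ fun s => by simp)
    refine ⟨hXint, ?_⟩
    rw [hS, hS₀]
    dsimp only
    rw [hId, integral_Ioc_eq_integral_Ioo, integral_congr_ae hae, integral_sub hXint hDN, integral_const_mul]
    ring
  -- ### the trilinear term is bounded by the kernel, the error is small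
  have hXbound : ∀ N, -(∫ s in Ioo 0 t, X N s) ≤
      (∫⁻ s in Ioo 0 t, ‖X N s - Y N s‖ₑ).toReal + (∫⁻ s in Ioo 0 t, K s).toReal := by
    intro N
    obtain ⟨hXint, -⟩ := hcross N
    have hYK : ∀ s ∈ Ioo 0 t, ‖Y N s‖ₑ ≤ K s := by
      intro s hs
      have hsT : s ∈ Ioc 0 T := Ioo_subset_Ioc_self (hsub hs)
      exact enorm_integral_inner_convect_truncate_le_of_budget (hu.memLp s ⟨hsT.1.le, hsT.2⟩)
        (hU.memLp s ⟨hsT.1.le, hsT.2⟩) (hb s (hsub hs)) N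
    have h1 : -(∫ s in Ioo 0 t, X N s) ≤ (∫⁻ s in Ioo 0 t, ‖X N s‖ₑ).toReal := by
      have h := norm_integral_le_lintegral_norm (μ := μ) (X N)
      simp_rw [ofReal_norm] at h
      rw [Real.norm_eq_abs] at h
      exact (neg_le_abs _).trans h
    have h2 : ∫⁻ s in Ioo 0 t, ‖X N s‖ₑ ≤ (∫⁻ s in Ioo 0 t, ‖X N s - Y N s‖ₑ) + ∫⁻ s in Ioo 0 t, K s := by
      calc ∫⁻ s in Ioo 0 t, ‖X N s‖ₑ ≤ ∫⁻ s in Ioo 0 t, (‖X N s - Y N s‖ₑ + ‖Y N s‖ₑ) :=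
            lintegral_mono fun s => by
              calc ‖X N s‖ₑ = ‖(X N s - Y N s) + Y N s‖ₑ := by rw [sub_add_cancel]
                _ ≤ _ := enorm_add_le _ _
        _ = (∫⁻ s in Ioo 0 t, ‖X N s - Y N s‖ₑ) + ∫⁻ s in Ioo 0 t, ‖Y N s‖ₑ := lintegral_add_left' (hFm N) _
        _ ≤ (∫⁻ s in Ioo 0 t, ‖X N s - Y N s‖ₑ) + ∫⁻ s in Ioo 0 t, K s :=
            add_le_add le_rfl (setLIntegral_mono' measurableSet_Ioo hYK)
    have hfin : (∫⁻ s in Ioo 0 t, ‖X N s - Y N s‖ₑ) + ∫⁻ s in Ioo 0 t, K s ≠ ⊤ :=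
      ENNReal.add_ne_top.2 ⟨hFfin N, hKtop⟩
    calc -(∫ s in Ioo 0 t, X N s) ≤ (∫⁻ s in Ioo 0 t, ‖X N s‖ₑ).toReal := h1
      _ ≤ ((∫⁻ s in Ioo 0 t, ‖X N s - Y N s‖ₑ) + ∫⁻ s in Ioo 0 t, K s).toReal := ENNReal.toReal_mono hfin h2
      _ = _ := ENNReal.toReal_add (hFfin N) hKtop
  -- ### the inequality at level `N`
  have hN : ∀ N, (∫ x, ‖u t x‖ ^ 2) + (∫ x, ‖U t x‖ ^ 2) - 2 * S N + 2 * ν * (Gu + GU - 2 * ∫ s in Ioo 0 t, D N s) ≤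
      (∫ x, ‖u₀ x‖ ^ 2) + (∫ x, ‖U₀ x‖ ^ 2) - 2 * S₀ N +
        2 * (∫⁻ s in Ioo 0 t, ‖X N s - Y N s‖ₑ).toReal + 2 * (∫⁻ s in Ioo 0 t, K s).toReal := by
    intro N
    obtain ⟨-, hId⟩ := hcross N
    have hb := hXbound N
    nlinarith [hId, hb, hEu, hEU]
  -- ### the limit `N → ∞`
  have hL : Tendsto (fun N => (∫ x, ‖u t x‖ ^ 2) + (∫ x, ‖U t x‖ ^ 2) - 2 * S N + 2 * ν * (Gu + GU - 2 * ∫ s in Ioo 0 t, D N s))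
      atTop (𝓝 ((∫ x, ‖u t x‖ ^ 2) + (∫ x, ‖U t x‖ ^ 2) - 2 * (∫ x, ⟪u t x, U t x⟫_ℝ) +
        2 * ν * (Gu + GU - 2 * ∫ s in Ioo 0 t, Dl s))) :=
    ((tendsto_const_nhds.sub (hSlim.const_mul 2)).add
      ((tendsto_const_nhds.sub (hDlim.const_mul 2)).const_mul (2 * ν)))
  have hR : Tendsto (fun N => (∫ x, ‖u₀ x‖ ^ 2) + (∫ x, ‖U₀ x‖ ^ 2) - 2 * S₀ N +
        2 * (∫⁻ s in Ioo 0 t, ‖X N s - Y N s‖ₑ).toReal + 2 * (∫⁻ s in Ioo 0 t, K s).toReal)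
      atTop (𝓝 ((∫ x, ‖u₀ x‖ ^ 2) + (∫ x, ‖U₀ x‖ ^ 2) - 2 * (∫ x, ⟪u₀ x, U₀ x⟫_ℝ) + 2 * 0 +
        2 * (∫⁻ s in Ioo 0 t, K s).toReal)) := by
    have h0 : Tendsto (fun N => (∫⁻ s in Ioo 0 t, ‖X N s - Y N s‖ₑ).toReal) atTop (𝓝 0) := by
      have h := (ENNReal.tendsto_toReal ENNReal.zero_ne_top).comp hFlim
      rwa [ENNReal.toReal_zero] at h
    exact ((tendsto_const_nhds.sub (hS₀lim.const_mul 2)).add (h0.const_mul 2)).add tendsto_const_nhds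
  have hlimit := le_of_tendsto_of_tendsto' hL hR hN
  rw [mul_zero, add_zero] at hlimit
  -- ### identification of the limit
  rw [← Torus.integral_norm_sub_sq_eq hut hUt, ← Torus.integral_norm_sub_sq_eq hu₀ hU₀, ← hGw] at hlimit
  -- ### back to `ℝ≥0∞`
  have hwt : MemLp (fun x => u t x - U t x) 2 volume := hut.sub hUt
  have hw0 : MemLp (fun x => u₀ x - U₀ x) 2 volume := hu₀.sub hU₀
  have h1 : (∫⁻ x, ‖u t x - U t x‖ₑ ^ 2) + 2 * ENNReal.ofReal ν * ∫⁻ s in Ioo 0 t, Torus.eGradNormSq (u s - U s) =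
      ENNReal.ofReal ((∫ x, ‖u t x - U t x‖ ^ 2) + 2 * ν * (∫⁻ s in Ioo 0 t, Torus.eGradNormSq (u s - U s)).toReal) := by
    rw [ENNReal.ofReal_add (integral_nonneg fun x => sq_nonneg _) (by positivity), ← Torus.lintegral_enorm_sq_eq_ofReal hwt,
      ENNReal.ofReal_mul (by positivity), ENNReal.ofReal_toReal hGw_fin, ENNReal.ofReal_mul (by norm_num),
      ENNReal.ofReal_ofNat]
  have h2 : ENNReal.ofReal ((∫ x, ‖u₀ x - U₀ x‖ ^ 2) + 2 * (∫⁻ s in Ioo 0 t, K s).toReal) ≤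
      (∫⁻ x, ‖u₀ x - U₀ x‖ₑ ^ 2) + 2 * ∫⁻ s in Ioo 0 t, K s := by
    rw [ENNReal.ofReal_add (integral_nonneg fun x => sq_nonneg _) (by positivity), ← Torus.lintegral_enorm_sq_eq_ofReal hw0,
      ENNReal.ofReal_mul (by norm_num), ENNReal.ofReal_ofNat, ENNReal.ofReal_toReal hKtop]
  rw [h1]
  exact (ENNReal.ofReal_le_ofReal hlimit).trans h2

/-- **Grönwall form of the budget inequality.** Under the hypotheses of
`lintegral_enorm_sub_sq_add_le_of_budget` with `∫₀ᵀ b < ∞`: for every `t ∈ (0,T]`,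
`∫‖u(t) - U(t)‖² ≤ ∫‖u₀ - U₀‖² · exp(2∫₀ᵗ b)` (the integral Grönwall lemma
`lintegral_gronwall_le`, Robinson–Rodrigo–Sadowski 2016, Lemma A.25, applied to
`t ↦ ∫‖u(t)-U(t)‖²` extended by `0` at `t = 0`, as in
`Torus.IsLerayHopfOn.lintegral_enorm_sub_sq_le_mul_exp_of_invariant`). No positivity of `ν` is
needed: the dissipation is simply discarded. [cite: RobinsonRodrigoSadowski2016, Lemma A.25] -/
theorem lintegral_enorm_sub_sq_le_mul_exp_of_budget {T ν : ℝ}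
    {u U : ℝ → UnitAddTorus (Fin 3) → EuclideanSpace ℝ (Fin 3)}
    {u₀ U₀ : UnitAddTorus (Fin 3) → EuclideanSpace ℝ (Fin 3)}
    (hu : Torus.IsLerayHopfOn T ν 0 u₀ u) (hU : Torus.IsLerayHopfOn T ν 0 U₀ U) (hν : 0 ≤ ν) (hT : 0 < T)
    (hu₀ : MemLp u₀ 2 volume) (hU₀ : MemLp U₀ 2 volume)
    (hUinv : ∀ (t : ℝ) (s : UnitAddCircle) (x : UnitAddTorus (Fin 3)), U t (x + Pi.single (2 : Fin 3) s) = U t x)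
    {b : ℝ → ℝ} (hb : ∀ s ∈ Ioo 0 T, ∀ F : Finset (Fin 3 → ℤ), ∑ k ∈ F, (2 * Real.pi * ∑ i, |(k i : ℝ)|) *
      ‖mFourierCoeff (EuclideanSpace.complexify ∘ U s) k‖ ≤ b s)
    (hbint : ∫⁻ s in Ioo 0 T, ENNReal.ofReal (b s) ≠ ⊤) :
    ∀ t ∈ Ioc 0 T, (∫⁻ x, ‖u t x - U t x‖ₑ ^ 2) ≤ (∫⁻ x, ‖u₀ x - U₀ x‖ₑ ^ 2) *
      ENNReal.ofReal (Real.exp (∫⁻ s in Ioo 0 t, 2 * ENNReal.ofReal (b s)).toReal) := by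
  -- ### notation
  set y : ℝ → ℝ≥0∞ := fun s => ∫⁻ x, ‖u s x - U s x‖ₑ ^ 2 with hy
  set a : ℝ → ℝ≥0∞ := fun s => 2 * ENNReal.ofReal (b s) with ha
  set B : ℝ≥0∞ := ∫⁻ x, ‖u₀ x - U₀ x‖ₑ ^ 2 with hB
  have hBtop : B ≠ ⊤ := by
    have h := Torus.lintegral_enorm_sq_eq_ofReal (hu₀.sub hU₀)
    simp only [Pi.sub_apply] at h
    rw [hB, h]
    exact ENNReal.ofReal_ne_top
  -- ### forces and measurability
  have hf0m : AEStronglyMeasurable (Torus.stLift (0 : ℝ → UnitAddTorus (Fin 3) → EuclideanSpace ℝ (Fin 3)))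
      (volume.restrict (Ioo 0 T ×ˢ univ)) := aestronglyMeasurable_const (b := (0 : EuclideanSpace ℝ (Fin 3)))
  have hf0 : ∫⁻ s in Ioo 0 T, ∫⁻ x : UnitAddTorus (Fin 3), ‖(0 : ℝ → UnitAddTorus (Fin 3) → EuclideanSpace ℝ (Fin 3)) s x‖ₑ ^ 2 < ⊤ := by simp
  have hu' := hu.aestronglyMeasurable_uncurry
  have hU' := hU.aestronglyMeasurable_uncurry
  have hy_meas : AEMeasurable y (volume.restrict (Ioo 0 T)) :=
    ((hu'.sub hU').aemeasurable.enorm.pow_const 2).lintegral_prod_right'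
  -- ### uniform `L²` bounds on `[0, T]`
  obtain ⟨Mu, hMu, hMu'⟩ := hu.exists_forall_lintegral_enorm_sq_le hν hf0m hf0
  obtain ⟨MU, hMU, hMU'⟩ := hU.exists_forall_lintegral_enorm_sq_le hν hf0m hf0
  have hybound : ∀ t ∈ Ioc 0 T, y t ≤ 2 * Mu + 2 * MU := by
    intro t ht
    have ht' : t ∈ Icc 0 T := ⟨ht.1.le, ht.2⟩
    have hmu : AEMeasurable (fun x => ‖u t x‖ₑ ^ 2) volume := (hu.memLp t ht').aestronglyMeasurable.enorm.pow_const _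
    calc y t ≤ ∫⁻ x, (2 * ‖u t x‖ₑ ^ 2 + 2 * ‖U t x‖ₑ ^ 2) := lintegral_mono fun x => enorm_sub_sq_le_two_mul _ _
      _ = 2 * (∫⁻ x, ‖u t x‖ₑ ^ 2) + 2 * ∫⁻ x, ‖U t x‖ₑ ^ 2 := by
          rw [lintegral_add_left' (hmu.const_mul _), lintegral_const_mul' _ _ ENNReal.ofNat_ne_top,
            lintegral_const_mul' _ _ ENNReal.ofNat_ne_top]
      _ ≤ 2 * Mu + 2 * MU := by gcongr <;> [exact hMu' t ht'; exact hMU' t ht']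
  -- ### the kernel `a` is integrable on `(0, T)`
  have haT : ∫⁻ s in Ioo 0 T, a s ≠ ⊤ := by
    have : ∫⁻ s in Ioo 0 T, a s = 2 * ∫⁻ s in Ioo 0 T, ENNReal.ofReal (b s) := by
      rw [ha, lintegral_const_mul' _ _ ENNReal.ofNat_ne_top]
    rw [this]
    exact ENNReal.mul_ne_top ENNReal.ofNat_ne_top hbint
  -- ### the integral inequality `y t ≤ B + ∫₀ᵗ a y` on `(0, T]`
  have hmain : ∀ t ∈ Ioc 0 T, y t ≤ B + ∫⁻ s in Ioo 0 t, a s * y s := by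
    intro t ht
    have hD := lintegral_enorm_sub_sq_add_le_of_budget hu hU hν hT hu₀ hU₀ hUinv hb ht
    have hay : ∫⁻ s in Ioo 0 t, a s * y s = 2 * ∫⁻ s in Ioo 0 t, ENNReal.ofReal (b s) * y s := by
      rw [ha, ← lintegral_const_mul' _ _ ENNReal.ofNat_ne_top]
      refine lintegral_congr fun s => ?_
      simp only [hy]
      ring
    rw [hay]
    exact le_self_add.trans hD
  -- ### Grönwall on `[0, T]` for the extension `φ` of `y` by `0` at `t = 0`
  set φ : ℝ → ℝ≥0∞ := fun s => if 0 < s then y s else 0 with hφ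
  have hφy : ∀ t, ∫⁻ s in Ioo 0 t, a s * φ s = ∫⁻ s in Ioo 0 t, a s * y s := by
    intro t
    refine setLIntegral_congr_fun measurableSet_Ioo fun s hs => ?_
    simp only [hφ, if_pos hs.1]
  have hM : 2 * Mu + 2 * MU ≠ ⊤ := ENNReal.add_ne_top.2
    ⟨ENNReal.mul_ne_top ENNReal.ofNat_ne_top hMu, ENNReal.mul_ne_top ENNReal.ofNat_ne_top hMU⟩
  have hφM : ∀ t ∈ Icc 0 T, φ t ≤ 2 * Mu + 2 * MU := by
    intro t ht
    by_cases h0 : 0 < t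
    · simp only [hφ, if_pos h0]; exact hybound t ⟨h0, ht.2⟩
    · simp only [hφ, if_neg h0]; exact bot_le
  have hφmain : ∀ t ∈ Icc 0 T, φ t ≤ B + ∫⁻ s in Ioo 0 t, a s * φ s := by
    intro t ht
    rw [hφy]
    by_cases h0 : 0 < t
    · simp only [hφ, if_pos h0]; exact hmain t ⟨h0, ht.2⟩
    · simp only [hφ, if_neg h0]; exact bot_le
  have hG := lintegral_gronwall_le (S := T) (φ := φ) (a := a) hBtop hM hφM haT hφmain
  intro t ht
  have h := hG t ⟨ht.1.le, ht.2⟩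
  simp only [hφ, if_pos ht.1] at h
  exact h


/-! ## The heat-flow shear: vanishing third component, budget, selection at the KH scale -/

/-- `1 - e^{-2λt} ≤ 2λ ∫₀ᵗ e^{-2λτ} dτ` in `ℝ≥0∞` (an identity for `λ > 0`, trivial for `λ = 0`),
`λ, t ≥ 0`. [folklore] -/
theorem ofReal_one_sub_exp_le_mul_lintegral_exp {l t : ℝ} (hl : 0 ≤ l) (ht : 0 ≤ t) :
    ENNReal.ofReal (1 - Real.exp (-(2 * l * t))) ≤
      ENNReal.ofReal (2 * l) * ∫⁻ τ in Ioo 0 t, ENNReal.ofReal (Real.exp (-(2 * l * τ))) := by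
  rcases hl.eq_or_lt with h0 | hl0
  · subst h0; simp
  have e : ∀ τ : ℝ, -(2 * l * τ) = (-(2 * l)) * τ := fun τ => by ring
  simp_rw [e]
  set m : ℝ := -(2 * l) with hm
  have hm0 : m ≠ 0 := by rw [hm]; exact neg_ne_zero.2 (by positivity)
  have hcont : Continuous fun τ : ℝ => Real.exp (m * τ) := Real.continuous_exp.comp (continuous_const.mul continuous_id)
  have hint : IntervalIntegrable (fun τ => Real.exp (m * τ)) volume 0 t := hcont.intervalIntegrable _ _
  have hderiv : ∀ x ∈ uIcc 0 t, HasDerivAt (fun τ => Real.exp (m * τ) / m) (Real.exp (m * x)) x := by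
    intro x _
    have h1 : HasDerivAt (fun τ => m * τ) m x := by simpa using (hasDerivAt_id x).const_mul m
    have h2 : HasDerivAt (fun τ => Real.exp (m * τ)) (Real.exp (m * x) * m) x := (Real.hasDerivAt_exp _).comp x h1
    have h3 := h2.div_const m
    rwa [mul_div_cancel_right₀ _ hm0] at h3
  have hI : ∫ τ in 0..t, Real.exp (m * τ) = (Real.exp (m * t) - 1) / m := by
    rw [intervalIntegral.integral_eq_sub_of_hasDerivAt hderiv hint]
    simp only [mul_zero, Real.exp_zero]
    field_simp
  have hnn : ∀ τ, 0 ≤ Real.exp (m * τ) := fun τ => (Real.exp_pos _).le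
  have hL : ∫⁻ τ in Ioo 0 t, ENNReal.ofReal (Real.exp (m * τ)) = ENNReal.ofReal (∫ τ in 0..t, Real.exp (m * τ)) := by
    rw [intervalIntegral.integral_of_le ht, integral_Ioc_eq_integral_Ioo,
      ofReal_integral_eq_lintegral_ofReal (hint.1.mono_set Ioo_subset_Ioc_self) (ae_of_all _ hnn)]
  rw [hL, hI, ← ENNReal.ofReal_mul (by positivity)]
  refine ENNReal.ofReal_le_ofReal (le_of_eq ?_)
  rw [hm]
  field_simp
  ring

/-- **For the datum `(v₁(x₂), 0, 0)` the shear-form Leray–Hopf solution has vanishing third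
component.** If `U = (a(t,x₂), 0, c(t,x₁,x₂))` is a Leray–Hopf weak solution on `T³ × [0,T)`
with viscosity `ν > 0` and datum `shearData v₁ 0 = (v₁(x₂), 0, 0)`, `v₁ ∈ L²(T)`, then
`c(t,·) = 0` a.e. for every `t ∈ (0,T]`. Energy bookkeeping: the first component is the heat
flow of `v₁` modewise (`mFourierCoeff_shear_first_eq`), whose own energy identity
`‖a(t)‖² + 2ν∫₀ᵗ‖∂₂a‖² = ‖v₁‖²` already saturates the Leray–Hopf energy inequality
`‖a(t)‖² + ‖c(t)‖² + 2ν∫₀ᵗ‖∇U‖₂² ≤ ‖v₁‖²`, leaving `‖c(t)‖₂² ≤ 0`. [folklore] -/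
theorem shearField_third_ae_eq_zero {v₁ : UnitAddCircle → ℝ} (hv₁ : MemLp v₁ 2 volume)
    {T ν : ℝ} (hT : 0 < T) (hν : 0 < ν) {a : ℝ → UnitAddCircle → ℝ} {c : ℝ → UnitAddTorus (Fin 2) → ℝ}
    (hU : Torus.IsLerayHopfOn T ν 0 (shearData v₁ 0) (shearField a c)) {t : ℝ} (ht : t ∈ Ioc 0 T) :
    (fun x : UnitAddTorus (Fin 3) => c t ![x 0, x 1]) =ᵐ[volume] 0 := by
  have ht' : t ∈ Icc 0 T := ⟨ht.1.le, ht.2⟩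
  have hv₃ : MemLp (0 : UnitAddTorus (Fin 2) → ℝ) 2 volume := MemLp.zero
  -- ### notation: the coefficients of `v₁` lifted to `T³`, the decay rates
  set A : (Fin 3 → ℤ) → ℂ := fun k => mFourierCoeff (fun x : UnitAddTorus (Fin 3) => ((v₁ (x 1) : ℝ) : ℂ)) k with hA
  set lam : (Fin 3 → ℤ) → ℝ := fun k => ν * (4 * Real.pi ^ 2 * freqNormSq k) with hlam
  have hlam0 : ∀ k, 0 ≤ lam k := fun k => by
    simp only [hlam]; exact mul_nonneg hν.le (mul_nonneg (by positivity) (freqNormSq_nonneg k))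
  have hexp : ∀ (k : Fin 3 → ℤ) (τ : ℝ),
      ‖((Real.exp (-(ν * (4 * Real.pi ^ 2 * freqNormSq k) * τ)) : ℝ) : ℂ)‖ₑ ^ 2 =
        ENNReal.ofReal (Real.exp (-(2 * lam k * τ))) := by
    intro k τ
    rw [← ofReal_norm, Complex.norm_real, Real.norm_eq_abs, abs_of_pos (Real.exp_pos _),
      ← ENNReal.ofReal_pow (Real.exp_pos _).le, ← Real.exp_nat_mul]
    have e : ((2 : ℕ) : ℝ) * -(ν * (4 * Real.pi ^ 2 * freqNormSq k) * τ) = -(2 * lam k * τ) := by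
      simp only [hlam]; push_cast; ring
    rw [e]
  -- ### the slices and their components
  have hUt : MemLp (shearField a c t) 2 volume := hU.memLp t ht'
  have hat : MemLp (fun x : UnitAddTorus (Fin 3) => a t (x 1)) 2 volume := by
    have h := hUt.eval_piLp 0
    simp_rw [(shearField_apply a c t _).1] at h
    exact h
  have hct : MemLp (fun x : UnitAddTorus (Fin 3) => c t ![x 0, x 1]) 2 volume := by
    have h := hUt.eval_piLp 2
    simp_rw [(shearField_apply a c t _).2.2] at h
    exact h
  have hV : MemLp (fun x : UnitAddTorus (Fin 3) => v₁ (x 1)) 2 volume :=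
    hv₁.comp_measurePreserving measurePreserving_eval_one
  have hreal : ∀ r : ℝ, ‖(r : ℂ)‖ₑ ^ 2 = ‖r‖ₑ ^ 2 := fun r => by
    rw [← ofReal_norm, ← ofReal_norm, Complex.norm_real]
  -- ### Parseval: `S = ∑‖A k‖² = ∫|v₁|² = ∫‖U₀‖²`
  set S : ℝ≥0∞ := ∑' k, ‖A k‖ₑ ^ 2 with hS
  have hS_eq : S = ∫⁻ x : UnitAddTorus (Fin 3), ‖v₁ (x 1)‖ₑ ^ 2 := by
    show (∑' k, ‖mFourierCoeff (fun x : UnitAddTorus (Fin 3) => ((v₁ (x 1) : ℝ) : ℂ)) k‖ₑ ^ 2) = _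
    exact (tsum_enorm_sq_mFourierCoeff (g := fun x : UnitAddTorus (Fin 3) => ((v₁ (x 1) : ℝ) : ℂ)) hV.ofReal).trans
      (lintegral_congr fun x => hreal _)
  have hS_top : S ≠ ⊤ := by
    rw [hS_eq, lintegral_enorm_sq_eq_ofReal_integral_sq_of_memLp hV]; exact ENNReal.ofReal_ne_top
  have hU₀ : ∫⁻ x, ‖shearData v₁ 0 x‖ₑ ^ 2 = S := by
    rw [hS_eq]
    refine lintegral_congr fun x => ?_
    have h : ‖shearData v₁ 0 x‖ₑ ^ 2 = ENNReal.ofReal (v₁ (x 1) ^ 2 + 0 ^ 2) := by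
      rw [show shearData v₁ 0 x = !₂[v₁ (x 1), 0, 0] by simp [shearData]]
      exact enorm_sq_vec3 _ _
    rw [h, Real.enorm_eq_ofReal_abs, ← ENNReal.ofReal_pow (abs_nonneg _), sq_abs]
    simp
  -- ### Parseval for `a(t)`: `∫|a(t)|² = ∑ e^{-2λt}‖A k‖²`
  have hPa : ∫⁻ x : UnitAddTorus (Fin 3), ‖a t (x 1)‖ₑ ^ 2 =
      ∑' k, ENNReal.ofReal (Real.exp (-(2 * lam k * t))) * ‖A k‖ₑ ^ 2 := by
    calc ∫⁻ x : UnitAddTorus (Fin 3), ‖a t (x 1)‖ₑ ^ 2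
        = ∫⁻ x : UnitAddTorus (Fin 3), ‖((a t (x 1) : ℝ) : ℂ)‖ₑ ^ 2 := lintegral_congr fun x => (hreal _).symm
      _ = ∑' k, ‖mFourierCoeff (fun x : UnitAddTorus (Fin 3) => ((a t (x 1) : ℝ) : ℂ)) k‖ₑ ^ 2 :=
          (tsum_enorm_sq_mFourierCoeff (g := fun x : UnitAddTorus (Fin 3) => ((a t (x 1) : ℝ) : ℂ)) hat.ofReal).symm
      _ = _ := tsum_congr fun k => by
          rw [mFourierCoeff_shear_first_eq hv₁ hv₃ hT hU ht k, enorm_mul, mul_pow, hexp k t]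
  -- ### the energy of the slice splits
  have hsplit : ∫⁻ x, ‖shearField a c t x‖ₑ ^ 2 =
      (∫⁻ x : UnitAddTorus (Fin 3), ‖a t (x 1)‖ₑ ^ 2) + ∫⁻ x : UnitAddTorus (Fin 3), ‖c t ![x 0, x 1]‖ₑ ^ 2 := by
    rw [← lintegral_add_left' (hat.aestronglyMeasurable.aemeasurable.enorm.pow_const _)]
    refine lintegral_congr fun x => ?_
    rw [show shearField a c t x = !₂[a t (x 1), 0, c t ![x 0, x 1]] from rfl, enorm_sq_vec3,
      ENNReal.ofReal_add (sq_nonneg _) (sq_nonneg _), Real.enorm_eq_ofReal_abs, Real.enorm_eq_ofReal_abs,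
      ← ENNReal.ofReal_pow (abs_nonneg _), ← ENNReal.ofReal_pow (abs_nonneg _), sq_abs, sq_abs]
  -- ### the energy inequality in `ℝ≥0∞`
  set G : ℝ≥0∞ := ∫⁻ τ in Ioo 0 t, eGradNormSq (shearField a c τ) with hG
  have hGtop : G ≠ ⊤ :=
    ne_top_of_le_ne_top hU.lintegral_eGradNormSq_lt_top.ne (lintegral_mono_set (Ioo_subset_Ioo le_rfl ht.2))
  have hE : (∫⁻ x, ‖shearField a c t x‖ₑ ^ 2) + ENNReal.ofReal (2 * ν) * G ≤ S := by
    have hen := hU.integral_norm_sq_add_le_of_zero_force ht'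
    rw [← hU₀, Torus.lintegral_enorm_sq_eq_ofReal hUt, Torus.lintegral_enorm_sq_eq_ofReal (memLp_shearData hv₁ hv₃),
      ← ENNReal.ofReal_toReal hGtop, ← ENNReal.ofReal_mul (by positivity),
      ← ENNReal.ofReal_add (integral_nonneg fun _ => sq_nonneg _) (by positivity)]
    exact ENNReal.ofReal_le_ofReal (by rw [hG]; linarith)
  -- ### the dissipation of the heat part from below
  have hD : ∑' k, ENNReal.ofReal (1 - Real.exp (-(2 * lam k * t))) * ‖A k‖ₑ ^ 2 ≤ ENNReal.ofReal (2 * ν) * G := by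
    -- pointwise in `τ`: the spectral gradient norm dominates the first component's modes
    have hpt : ∀ τ ∈ Ioo 0 t, ENNReal.ofReal (4 * Real.pi ^ 2) *
        ∑' k, ENNReal.ofReal (freqNormSq k) * (ENNReal.ofReal (Real.exp (-(2 * lam k * τ))) * ‖A k‖ₑ ^ 2) ≤
        eGradNormSq (shearField a c τ) := by
      intro τ hτ
      have hτ' : τ ∈ Ioc 0 T := ⟨hτ.1, hτ.2.le.trans ht.2⟩
      have hUτi : Integrable (EuclideanSpace.complexify ∘ shearField a c τ) volume :=
        integrable_complexify_comp ((hU.memLp τ ⟨hτ'.1.le, hτ'.2⟩).integrable one_le_two)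
      rw [eGradNormSq_eq_tsum]
      refine mul_le_mul' le_rfl (ENNReal.tsum_le_tsum fun k => mul_le_mul' le_rfl ?_)
      calc ENNReal.ofReal (Real.exp (-(2 * lam k * τ))) * ‖A k‖ₑ ^ 2
          = ‖mFourierCoeff (fun x : UnitAddTorus (Fin 3) => ((a τ (x 1) : ℝ) : ℂ)) k‖ₑ ^ 2 := by
            rw [mFourierCoeff_shear_first_eq hv₁ hv₃ hT hU hτ' k, enorm_mul, mul_pow, hexp k τ]
        _ = ‖mFourierCoeff (EuclideanSpace.complexify ∘ shearField a c τ) k 0‖ₑ ^ 2 := by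
            rw [mFourierCoeff_apply_euclidean hUτi k 0]
            congr 3
        _ ≤ ‖mFourierCoeff (EuclideanSpace.complexify ∘ shearField a c τ) k‖ₑ ^ 2 := by
            rw [enorm_sq_eq_sum_euclidean (mFourierCoeff (EuclideanSpace.complexify ∘ shearField a c τ) k)]
            exact Finset.single_le_sum (f := fun i => ‖mFourierCoeff (EuclideanSpace.complexify ∘ shearField a c τ) k i‖ₑ ^ 2)
              (fun i _ => by positivity) (Finset.mem_univ 0)
    -- integrate in `τ` and sum
    have hmk : ∀ k, AEMeasurable (fun τ => ENNReal.ofReal (Real.exp (-(2 * lam k * τ)))) (volume.restrict (Ioo 0 t)) :=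
      fun k => (Real.continuous_exp.comp (continuous_const.mul continuous_id).neg).measurable.ennreal_ofReal.aemeasurable
    have hmeas : ∀ k, AEMeasurable (fun τ => ENNReal.ofReal (freqNormSq k) *
        (ENNReal.ofReal (Real.exp (-(2 * lam k * τ))) * ‖A k‖ₑ ^ 2)) (volume.restrict (Ioo 0 t)) :=
      fun k => ((hmk k).mul_const _).const_mul _
    have hAk : ∀ k, ‖A k‖ₑ ^ 2 ≠ ⊤ := fun k => ENNReal.pow_ne_top enorm_ne_top
    calc ∑' k, ENNReal.ofReal (1 - Real.exp (-(2 * lam k * t))) * ‖A k‖ₑ ^ 2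
        ≤ ∑' k, (ENNReal.ofReal (2 * lam k) * ∫⁻ τ in Ioo 0 t, ENNReal.ofReal (Real.exp (-(2 * lam k * τ)))) * ‖A k‖ₑ ^ 2 :=
          ENNReal.tsum_le_tsum fun k => mul_le_mul' (ofReal_one_sub_exp_le_mul_lintegral_exp (hlam0 k) ht.1.le) le_rfl
      _ = ENNReal.ofReal (2 * ν) * (ENNReal.ofReal (4 * Real.pi ^ 2) * ∑' k, ∫⁻ τ in Ioo 0 t,
            ENNReal.ofReal (freqNormSq k) * (ENNReal.ofReal (Real.exp (-(2 * lam k * τ))) * ‖A k‖ₑ ^ 2)) := by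
          rw [← ENNReal.tsum_mul_left, ← ENNReal.tsum_mul_left]
          refine tsum_congr fun k => ?_
          rw [lintegral_const_mul' _ _ ENNReal.ofReal_ne_top, lintegral_mul_const' _ _ (hAk k)]
          have e : ENNReal.ofReal (2 * lam k) =
              ENNReal.ofReal (2 * ν) * (ENNReal.ofReal (4 * Real.pi ^ 2) * ENNReal.ofReal (freqNormSq k)) := by
            rw [← ENNReal.ofReal_mul (by positivity), ← ENNReal.ofReal_mul (by positivity)]
            congr 1; simp only [hlam]; ring
          rw [e]
          ring
      _ = ENNReal.ofReal (2 * ν) * ∫⁻ τ in Ioo 0 t, ENNReal.ofReal (4 * Real.pi ^ 2) *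
            ∑' k, ENNReal.ofReal (freqNormSq k) * (ENNReal.ofReal (Real.exp (-(2 * lam k * τ))) * ‖A k‖ₑ ^ 2) := by
          rw [lintegral_const_mul' _ _ ENNReal.ofReal_ne_top, lintegral_tsum hmeas]
      _ ≤ ENNReal.ofReal (2 * ν) * G := by
          rw [hG]
          exact mul_le_mul' le_rfl (setLIntegral_mono' measurableSet_Ioo hpt)
  -- ### bookkeeping: `S + ∫|c(t)|² ≤ S`
  have hsum : (∑' k, ENNReal.ofReal (Real.exp (-(2 * lam k * t))) * ‖A k‖ₑ ^ 2) +
      ∑' k, ENNReal.ofReal (1 - Real.exp (-(2 * lam k * t))) * ‖A k‖ₑ ^ 2 = S := by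
    rw [← ENNReal.tsum_add, hS]
    refine tsum_congr fun k => ?_
    have h1 : 0 ≤ Real.exp (-(2 * lam k * t)) := (Real.exp_pos _).le
    have h2 : 0 ≤ 1 - Real.exp (-(2 * lam k * t)) := by
      rw [sub_nonneg]; exact Real.exp_le_one_iff.2 (by nlinarith [hlam0 k, ht.1])
    rw [← add_mul, ← ENNReal.ofReal_add h1 h2, add_sub_cancel, ENNReal.ofReal_one, one_mul]
  have hfinal : S + ∫⁻ x : UnitAddTorus (Fin 3), ‖c t ![x 0, x 1]‖ₑ ^ 2 ≤ S + 0 := by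
    calc S + ∫⁻ x : UnitAddTorus (Fin 3), ‖c t ![x 0, x 1]‖ₑ ^ 2
        = (∑' k, ENNReal.ofReal (Real.exp (-(2 * lam k * t))) * ‖A k‖ₑ ^ 2) +
            (∫⁻ x : UnitAddTorus (Fin 3), ‖c t ![x 0, x 1]‖ₑ ^ 2) +
            ∑' k, ENNReal.ofReal (1 - Real.exp (-(2 * lam k * t))) * ‖A k‖ₑ ^ 2 := by rw [← hsum]; ring
      _ ≤ (∫⁻ x, ‖shearField a c t x‖ₑ ^ 2) + ENNReal.ofReal (2 * ν) * G := by
          rw [hsplit, hPa]; exact add_le_add le_rfl hD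
      _ ≤ S := hE
      _ = S + 0 := (add_zero _).symm
  have hzero : ∫⁻ x : UnitAddTorus (Fin 3), ‖c t ![x 0, x 1]‖ₑ ^ 2 = 0 :=
    le_antisymm ((ENNReal.add_le_add_iff_left hS_top).1 hfinal) bot_le
  have hmeas : AEMeasurable (fun x : UnitAddTorus (Fin 3) => ‖c t ![x 0, x 1]‖ₑ ^ 2) volume :=
    hct.aestronglyMeasurable.aemeasurable.enorm.pow_const _
  filter_upwards [(lintegral_eq_zero_iff' hmeas).1 hzero] with x hx
  simpa using hx


/-- **Half Gaussian lattice sums**: for `c > 0` and a finite set `S` of integers,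
`∑_{n ∈ S, n > 0} e^{-cn²} ≤ ∫₀^∞ e^{-cx²} dx = ½√(π/c)` (the summand is decreasing on
`[0,∞)`, so each term is at most the integral over `[n-1, n]`). [folklore] -/
theorem sum_exp_neg_mul_sq_pos_le {c : ℝ} (hc : 0 < c) (S : Finset ℤ) :
    ∑ n ∈ S, (if 0 < n then Real.exp (-c * (n : ℝ) ^ 2) else 0) ≤ Real.sqrt (Real.pi / c) / 2 := by
  classical
  set f : ℝ → ℝ := fun x => Real.exp (-c * x ^ 2) with hf
  have hf0 : ∀ x, 0 ≤ f x := fun x => (Real.exp_pos _).le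
  have hanti : AntitoneOn f (Ici 0) := by
    intro x hx y _ hxy
    simp only [hf]
    exact Real.exp_le_exp.2 (by nlinarith [mul_le_mul hxy hxy hx (hx.trans hxy)])
  -- positive part of `S`, re-indexed by `m = n - 1 ∈ ℕ`
  set Sp : Finset ℤ := S.filter fun n => 0 < n with hSp
  set φ : ℤ → ℕ := fun n => n.toNat - 1 with hφ
  set N : ℕ := S.sup Int.toNat with hN
  have hcast : ∀ n ∈ Sp, ((φ n + 1 : ℕ) : ℝ) = (n : ℝ) := by
    intro n hn
    have hn0 : 0 < n := (Finset.mem_filter.1 hn).2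
    have h1 : (φ n + 1 : ℕ) = n.toNat := by
      simp only [hφ]; omega
    rw [h1]
    have h2 : ((n.toNat : ℤ) : ℝ) = (n : ℝ) := by rw [Int.toNat_of_nonneg hn0.le]
    exact_mod_cast h2
  have hinj : Set.InjOn φ Sp := by
    intro n hn m hm hnm
    have hn0 : 0 < n := (Finset.mem_filter.1 (Finset.mem_coe.1 hn)).2
    have hm0 : 0 < m := (Finset.mem_filter.1 (Finset.mem_coe.1 hm)).2
    simp only [hφ] at hnm
    omega
  have hsub : Sp.image φ ⊆ Finset.range N := by
    intro m hm
    obtain ⟨n, hn, rfl⟩ := Finset.mem_image.1 hm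
    have hn' := Finset.mem_filter.1 hn
    have hle : n.toNat ≤ N := Finset.le_sup (f := Int.toNat) hn'.1
    simp only [hφ, Finset.mem_range]
    omega
  calc ∑ n ∈ S, (if 0 < n then Real.exp (-c * (n : ℝ) ^ 2) else 0)
      = ∑ n ∈ Sp, f n := by rw [hSp, Finset.sum_filter]
    _ = ∑ n ∈ Sp, f ((φ n + 1 : ℕ) : ℝ) := Finset.sum_congr rfl fun n hn => by rw [hcast n hn]
    _ = ∑ m ∈ Sp.image φ, f ((m + 1 : ℕ) : ℝ) := (Finset.sum_image (f := fun m : ℕ => f ((m + 1 : ℕ) : ℝ)) hinj).symm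
    _ ≤ ∑ m ∈ Finset.range N, f ((m + 1 : ℕ) : ℝ) :=
        Finset.sum_le_sum_of_subset_of_nonneg hsub fun m _ _ => hf0 _
    _ = ∑ m ∈ Finset.range N, f (0 + ((m + 1 : ℕ) : ℝ)) := by simp
    _ ≤ ∫ x in (0 : ℝ)..0 + N, f x :=
        AntitoneOn.sum_le_integral (hanti.mono (Icc_subset_Ici_self))
    _ ≤ ∫ x in Ioi (0 : ℝ), f x := by
        rw [zero_add, intervalIntegral.integral_of_le (Nat.cast_nonneg N)]
        exact setIntegral_mono_set (integrable_exp_neg_mul_sq hc).integrableOn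
          (ae_of_all _ hf0) (ae_of_all _ Ioc_subset_Ioi_self)
    _ = Real.sqrt (Real.pi / c) / 2 := integral_gaussian_Ioi c

/-- **Gaussian lattice sums off the origin**: `∑_{n ∈ S, n ≠ 0} e^{-cn²} ≤ √(π/c)` for `c > 0`
and finite `S ⊆ ℤ` (twice `sum_exp_neg_mul_sq_pos_le`, by the symmetry `n ↦ -n`). [folklore] -/
theorem sum_exp_neg_mul_sq_ne_zero_le {c : ℝ} (hc : 0 < c) (S : Finset ℤ) :
    ∑ n ∈ S, (if n = 0 then 0 else Real.exp (-c * (n : ℝ) ^ 2)) ≤ Real.sqrt (Real.pi / c) := by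
  classical
  have hsplit : ∀ n : ℤ, (if n = 0 then 0 else Real.exp (-c * (n : ℝ) ^ 2)) =
      (if 0 < n then Real.exp (-c * (n : ℝ) ^ 2) else 0) + (if 0 < -n then Real.exp (-c * ((-n : ℤ) : ℝ) ^ 2) else 0) := by
    intro n
    rcases lt_trichotomy n 0 with h | h | h
    · rw [if_neg h.ne, if_neg (not_lt.2 h.le), if_pos (neg_pos.2 h), zero_add]
      push_cast; ring_nf
    · subst h; simp
    · rw [if_neg h.ne', if_pos h, if_neg (by omega), add_zero]
  simp_rw [hsplit, Finset.sum_add_distrib]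
  have h1 := sum_exp_neg_mul_sq_pos_le hc S
  have h2 : ∑ n ∈ S, (if 0 < -n then Real.exp (-c * ((-n : ℤ) : ℝ) ^ 2) else 0) ≤ Real.sqrt (Real.pi / c) / 2 := by
    rw [← Finset.sum_image (f := fun m : ℤ => if 0 < m then Real.exp (-c * (m : ℝ) ^ 2) else 0)
      (s := S) (g := fun n : ℤ => -n) (fun n _ m _ h => neg_injective h)]
    exact sum_exp_neg_mul_sq_pos_le hc _
  linarith


/-- The `x₂`-frequency axis `n ↦ (0, n, 0) = Pi.single 1 n` recovers its parameter at index `1`. [folklore] -/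
theorem single_one_apply_one (n : ℤ) : (Pi.single (1 : Fin 3) n : Fin 3 → ℤ) 1 = n := by simp

/-- A frequency with `k₀ = k₂ = 0` lies on the `x₂`-axis: `k = Pi.single 1 (k 1)`. [folklore] -/
theorem eq_single_one_of_axis {k : Fin 3 → ℤ} (hk : k 0 = 0 ∧ k 2 = 0) : k = Pi.single (1 : Fin 3) (k 1) := by
  funext i; fin_cases i <;> simp [hk.1, hk.2]

/-- **Axis reduction of a lattice sum**: a function on `ℤ³` supported on the `x₂`-axis and
depending only on `k₂` there sums, over any finite `F`, to the sum of its profile over the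
finite set of `k₂`'s met. [folklore] -/
theorem sum_axis_eq_sum_preimage (F : Finset (Fin 3 → ℤ)) (G : ℤ → ℝ) :
    ∑ k ∈ F, (if k 0 = 0 ∧ k 2 = 0 then G (k 1) else 0) =
      ∑ n ∈ F.preimage (Pi.single (1 : Fin 3)) (Pi.single_injective (M := fun _ : Fin 3 => ℤ) (1 : Fin 3)).injOn, G n := by
  classical
  rw [← Finset.sum_preimage (Pi.single (1 : Fin 3)) F (Pi.single_injective (M := fun _ : Fin 3 => ℤ) (1 : Fin 3)).injOn
    (fun k => if k 0 = 0 ∧ k 2 = 0 then G (k 1) else 0) ?_]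
  · refine Finset.sum_congr rfl fun n _ => ?_
    rw [if_pos (by simp), single_one_apply_one]
  · intro k _ hk
    by_cases h : k 0 = 0 ∧ k 2 = 0
    · exact (hk ⟨k 1, (eq_single_one_of_axis h).symm⟩).elim
    · rw [if_neg h]

/-- **The Lipschitz budget of the heat-flow shear** (the vortex-sheet scale `ν^{-1/2}`). Let
`U = (a(t,x₂), 0, c(t,x₁,x₂))` be a Leray–Hopf weak solution on `T³ × [0,T)` with viscosity
`ν > 0` and datum `(v₁(x₂), 0, 0)`, where the Fourier coefficients of `v₁` decay like those of a
function of bounded variation: `|k₂| · |v̂₁(k₂)| ≤ M` (e.g. `M = TV(v₁)/(2π)`; for Székelyhidi's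
vortex sheet `v₁ = ±1`, `v̂₁(k₂) = (1 - (-1)^{k₂})/(πik₂)` and `M = 2/π`). Then for every
`s ∈ (0,T)` and every finite set of frequencies `F`,
`∑_{k ∈ F} 2π(∑ᵢ|kᵢ|) ‖Û(k,s)‖ ≤ M √(π/(νs))`: the slice `U(s)` is the heat flow
`(e^{νs∂₂²}v₁, 0, 0)` (`mFourierCoeff_shear_first_eq`, `shearField_third_ae_eq_zero`), whose
coefficients live on the `k₂`-axis with `2π|k₂| e^{-4π²νk₂²s}|v̂₁(k₂)| ≤ 2πM e^{-4π²νs k₂²}`, and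
`∑_{k₂ ≠ 0} e^{-4π²νs k₂²} ≤ √(π/(4π²νs))` (`sum_exp_neg_mul_sq_ne_zero_le`). This is the
`L¹(0,T)` budget `∫₀ᵀ M√(π/(νs)) ds = 2M√(πT/ν)` replacing the `L²`-enstrophy budget
`‖∇U‖₂² ~ ν⁻¹` of the anisotropic-Ladyzhenskaya route. [folklore] -/
theorem sum_budget_shearHeat_le {v₁ : UnitAddCircle → ℝ} (hv₁ : MemLp v₁ 2 volume) {M : ℝ}
    (hM : ∀ k : Fin 3 → ℤ, |(k 1 : ℝ)| * ‖mFourierCoeff (fun x : UnitAddTorus (Fin 3) => ((v₁ (x 1) : ℝ) : ℂ)) k‖ ≤ M)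
    {T ν : ℝ} (hT : 0 < T) (hν : 0 < ν) {a : ℝ → UnitAddCircle → ℝ} {c : ℝ → UnitAddTorus (Fin 2) → ℝ}
    (hU : Torus.IsLerayHopfOn T ν 0 (shearData v₁ 0) (shearField a c)) {s : ℝ} (hs : s ∈ Ioo 0 T)
    (F : Finset (Fin 3 → ℤ)) :
    ∑ k ∈ F, (2 * Real.pi * ∑ i, |(k i : ℝ)|) * ‖mFourierCoeff (EuclideanSpace.complexify ∘ shearField a c s) k‖ ≤
      M * Real.sqrt (Real.pi / (ν * s)) := by
  classical
  have hs' : s ∈ Ioc 0 T := ⟨hs.1, hs.2.le⟩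
  have hv₃ : MemLp (0 : UnitAddTorus (Fin 2) → ℝ) 2 volume := MemLp.zero
  set A : (Fin 3 → ℤ) → ℂ := fun k => mFourierCoeff (fun x : UnitAddTorus (Fin 3) => ((v₁ (x 1) : ℝ) : ℂ)) k with hA
  have hM0 : 0 ≤ M := by
    have h := hM (Pi.single (1 : Fin 3) 1)
    rw [single_one_apply_one, Int.cast_one, abs_one, one_mul] at h
    exact (norm_nonneg _).trans h
  set cs : ℝ := 4 * Real.pi ^ 2 * ν * s with hcs
  have hcs0 : 0 < cs := by rw [hcs]; exact mul_pos (mul_pos (by positivity) hν) hs.1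
  -- ### the coefficients of the slice `U(s)`: only the heat-flow first component survives
  have hUsi : Integrable (EuclideanSpace.complexify ∘ shearField a c s) volume :=
    integrable_complexify_comp ((hU.memLp s ⟨hs'.1.le, hs'.2⟩).integrable one_le_two)
  have hcoef : ∀ k, ‖mFourierCoeff (EuclideanSpace.complexify ∘ shearField a c s) k‖ =
      Real.exp (-(ν * (4 * Real.pi ^ 2 * freqNormSq k) * s)) * ‖A k‖ := by
    intro k
    set w := mFourierCoeff (EuclideanSpace.complexify ∘ shearField a c s) k with hw
    have h0 : w 0 = (Real.exp (-(ν * (4 * Real.pi ^ 2 * freqNormSq k) * s)) : ℂ) * A k := by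
      rw [hw, mFourierCoeff_apply_euclidean hUsi k 0, ← mFourierCoeff_shear_first_eq hv₁ hv₃ hT hU hs' k]
      congr 1
    have h1 : w 1 = 0 := by
      rw [hw, mFourierCoeff_apply_euclidean hUsi k 1]
      have : (fun x => (EuclideanSpace.complexify ∘ shearField a c s) x 1) = fun _ => (0 : ℂ) := by
        funext x; simp [shearField]
      rw [this]; simp [mFourierCoeff]
    have h2 : w 2 = 0 := by
      rw [hw, mFourierCoeff_apply_euclidean hUsi k 2]
      have hae : (fun x => (EuclideanSpace.complexify ∘ shearField a c s) x 2) =ᵐ[volume] fun _ => (0 : ℂ) := by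
        filter_upwards [shearField_third_ae_eq_zero hv₁ hT hν hU hs'] with x hx
        simp only [Pi.zero_apply] at hx
        simp [shearField, hx]
      rw [mFourierCoeff_congr_ae hae]; simp [mFourierCoeff]
    have hsq : ‖w‖ ^ 2 = ‖w 0‖ ^ 2 := by
      rw [EuclideanSpace.norm_sq_eq, Fin.sum_univ_three, h1, h2, norm_zero]; ring
    have hn : ‖w‖ = ‖w 0‖ := by
      rw [← Real.sqrt_sq (norm_nonneg w), hsq, Real.sqrt_sq (norm_nonneg _)]
    rw [hn, h0, norm_mul, Complex.norm_real, Real.norm_eq_abs, abs_of_pos (Real.exp_pos _)]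
  -- ### termwise bound by an axis profile
  have hAoff : ∀ k : Fin 3 → ℤ, ¬(k 0 = 0 ∧ k 2 = 0) → A k = 0 := by
    intro k hk
    rcases not_and_or.1 hk with h0 | h2
    · exact mFourierCoeff_eq_zero_of_forall_add_single (i := 0) (fun s x => by simp) h0
    · exact mFourierCoeff_eq_zero_of_forall_add_single (i := 2) (fun s x => by simp) h2
  set G : ℤ → ℝ := fun n => if n = 0 then 0 else Real.exp (-cs * (n : ℝ) ^ 2) with hG
  have hG0 : ∀ n, 0 ≤ G n := fun n => by
    simp only [hG]; split_ifs <;> [exact le_rfl; exact (Real.exp_pos _).le]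
  have hterm : ∀ k : Fin 3 → ℤ, (2 * Real.pi * ∑ i, |(k i : ℝ)|) *
      ‖mFourierCoeff (EuclideanSpace.complexify ∘ shearField a c s) k‖ ≤
      if k 0 = 0 ∧ k 2 = 0 then 2 * Real.pi * M * G (k 1) else 0 := by
    intro k
    rw [hcoef k]
    by_cases hk : k 0 = 0 ∧ k 2 = 0
    · rw [if_pos hk]
      have hsum : ∑ i, |(k i : ℝ)| = |(k 1 : ℝ)| := by
        rw [Fin.sum_univ_three, hk.1, hk.2]; simp
      have hfreq : freqNormSq k = (k 1 : ℝ) ^ 2 := by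
        rw [freqNormSq, Fin.sum_univ_three, hk.1, hk.2]; simp
      rw [hsum, hfreq]
      by_cases h1 : k 1 = 0
      · simp [hG, h1]
      · simp only [hG, if_neg h1]
        have hexp : Real.exp (-(ν * (4 * Real.pi ^ 2 * (k 1 : ℝ) ^ 2) * s)) = Real.exp (-cs * (k 1 : ℝ) ^ 2) := by
          congr 1; simp only [hcs]; ring
        rw [hexp]
        calc 2 * Real.pi * |(k 1 : ℝ)| * (Real.exp (-cs * (k 1 : ℝ) ^ 2) * ‖A k‖)
            = 2 * Real.pi * (|(k 1 : ℝ)| * ‖A k‖) * Real.exp (-cs * (k 1 : ℝ) ^ 2) := by ring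
          _ ≤ 2 * Real.pi * M * Real.exp (-cs * (k 1 : ℝ) ^ 2) := by
              gcongr
              exact hM k
    · rw [if_neg hk, hAoff k hk, norm_zero, mul_zero, mul_zero]
  -- ### sum up
  calc ∑ k ∈ F, (2 * Real.pi * ∑ i, |(k i : ℝ)|) * ‖mFourierCoeff (EuclideanSpace.complexify ∘ shearField a c s) k‖
      ≤ ∑ k ∈ F, (if k 0 = 0 ∧ k 2 = 0 then 2 * Real.pi * M * G (k 1) else 0) := Finset.sum_le_sum fun k _ => hterm k
    _ = ∑ n ∈ F.preimage (Pi.single (1 : Fin 3)) (Pi.single_injective (M := fun _ : Fin 3 => ℤ) (1 : Fin 3)).injOn, (fun n => 2 * Real.pi * M * G n) n :=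
        sum_axis_eq_sum_preimage F (fun n => 2 * Real.pi * M * G n)
    _ = ∑ n ∈ F.preimage (Pi.single (1 : Fin 3)) (Pi.single_injective (M := fun _ : Fin 3 => ℤ) (1 : Fin 3)).injOn, 2 * Real.pi * M * G n := rfl
    _ = 2 * Real.pi * M * ∑ n ∈ F.preimage (Pi.single (1 : Fin 3)) (Pi.single_injective (M := fun _ : Fin 3 => ℤ) (1 : Fin 3)).injOn, G n := by
        rw [Finset.mul_sum]
    _ ≤ 2 * Real.pi * M * Real.sqrt (Real.pi / cs) := by
        gcongr
        exact sum_exp_neg_mul_sq_ne_zero_le hcs0 _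
    _ = M * Real.sqrt (Real.pi / (ν * s)) := by
        have hπ : 0 < Real.pi := Real.pi_pos
        have h4 : Real.sqrt (Real.pi / cs) = Real.sqrt (Real.pi / (ν * s)) / (2 * Real.pi) := by
          rw [eq_div_iff (by positivity), hcs]
          rw [show Real.pi / (ν * s) = (Real.pi / (4 * Real.pi ^ 2 * ν * s)) * (2 * Real.pi) ^ 2 by
            field_simp; ring]
          rw [Real.sqrt_mul (by positivity), Real.sqrt_sq (by positivity)]
        rw [h4]
        field_simp


/-- **The time integral of the vortex-sheet budget**: `∫₀ᵗ M√(π/(νs)) ds = 2M√(πt/ν)`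
(`∫₀ᵗ s^{-1/2} ds = 2√t`), in `ℝ≥0∞`. [folklore] -/
theorem lintegral_budget_eq {M ν t : ℝ} (hM : 0 ≤ M) (hν : 0 < ν) (ht : 0 ≤ t) :
    ∫⁻ s in Ioo 0 t, ENNReal.ofReal (M * Real.sqrt (Real.pi / (ν * s))) =
      ENNReal.ofReal (2 * M * Real.sqrt (Real.pi * t / ν)) := by
  have hr : (-1 : ℝ) < -(1 / 2) := by norm_num
  -- the integrand as a power on `(0, t)`
  have hpt : ∀ s ∈ Ioo 0 t, M * Real.sqrt (Real.pi / (ν * s)) = M * Real.sqrt (Real.pi / ν) * s ^ (-(1 / 2) : ℝ) := by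
    intro s hs
    rw [mul_assoc]
    congr 1
    rw [Real.rpow_neg hs.1.le, ← Real.sqrt_eq_rpow, ← Real.sqrt_inv, ← Real.sqrt_mul (div_nonneg Real.pi_pos.le hν.le)]
    congr 1
    field_simp
  have hint : IntervalIntegrable (fun s : ℝ => s ^ (-(1 / 2) : ℝ)) volume 0 t :=
    intervalIntegral.intervalIntegrable_rpow' hr
  have hI : ∫ s in (0 : ℝ)..t, s ^ (-(1 / 2) : ℝ) = 2 * Real.sqrt t := by
    rw [integral_rpow (Or.inl hr)]
    norm_num
    rw [Real.sqrt_eq_rpow]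
    ring
  have hnn : ∀ s ∈ Ioo 0 t, 0 ≤ M * Real.sqrt (Real.pi / ν) * s ^ (-(1 / 2) : ℝ) :=
    fun s hs => mul_nonneg (mul_nonneg hM (Real.sqrt_nonneg _)) (Real.rpow_nonneg hs.1.le _)
  calc ∫⁻ s in Ioo 0 t, ENNReal.ofReal (M * Real.sqrt (Real.pi / (ν * s)))
      = ∫⁻ s in Ioo 0 t, ENNReal.ofReal (M * Real.sqrt (Real.pi / ν) * s ^ (-(1 / 2) : ℝ)) :=
        setLIntegral_congr_fun measurableSet_Ioo fun s hs => by rw [hpt s hs]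
    _ = ENNReal.ofReal (∫ s in Ioo 0 t, M * Real.sqrt (Real.pi / ν) * s ^ (-(1 / 2) : ℝ)) := by
        rw [ofReal_integral_eq_lintegral_ofReal]
        · exact ((hint.1.mono_set Ioo_subset_Ioc_self).const_mul _)
        · exact (ae_restrict_mem measurableSet_Ioo).mono hnn
    _ = ENNReal.ofReal (2 * M * Real.sqrt (Real.pi * t / ν)) := by
        congr 1
        rw [integral_const_mul, ← integral_Ioc_eq_integral_Ioo, ← intervalIntegral.integral_of_le ht, hI,
          show Real.pi * t / ν = (Real.pi / ν) * t by ring, Real.sqrt_mul (div_nonneg Real.pi_pos.le hν.le)]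
        ring

/-- **Bardos–Titi–Wiedemann 2012, Thm. 5, for data converging to a vortex-sheet shear datum at
the Kelvin–Helmholtz rate `exp(-c/√ν)`** (proved; sharpens the reach of
`BardosTitiWiedemann2012_thm5_perturbedData`, whose modulus is `exp(-c/ν²)`, for shear profiles
with Fourier coefficients `O(1/|k₂|)`). Let `v₀ = (v₁(x₂), 0, 0)` with `v₁ ∈ L²(T)` and
`|k₂|·|v̂₁(k₂)| ≤ M` for all `k₂` (every profile of bounded variation, `M = TV(v₁)/(2π)`; the flat
vortex sheet `v₁ = sgn x₂` of Székelyhidi 2011 / Bardos–Titi–Wiedemann 2012, Cor. 2, has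
`M = 2/π`), let `T > 0`, `ν_j > 0`, `ν_j → 0`, and let `u_j` be Leray–Hopf weak solutions of the
unforced Navier–Stokes equations on `T³ × [0,T)` with viscosity `ν_j` and arbitrary `L²` data
`u₀ʲ` with `‖u₀ʲ - v₀‖₂² · exp(4M√(πT/ν_j)) → 0`. Then `u_j ⇀* v₀` (the steady shear flow
`shearFlow v₁ 0`) in `L^∞(0,T;L²(T³))`. Proof: the relative energy inequality against the exact
heat-flow shear `U_j = (e^{ν_jt∂₂²}v₁, 0, 0)` with the `ℓ¹`-Lipschitz budget
`‖∇U_j(s)‖ ≤ M√(π/(ν_js))` (`lintegral_enorm_sub_sq_le_mul_exp_of_budget`,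
`sum_budget_shearHeat_le`, `lintegral_budget_eq`) gives
`sup_{t ≤ T} ‖u_j(t) - U_j(t)‖₂² ≤ ‖u₀ʲ - v₀‖₂² exp(4M√(πT/ν_j)) → 0`, and `U_j ⇀* v₀` by
`BardosTitiWiedemann2012_thm5_holds`.

BARRIER (D-0021):
- technique_class: viscosity-limit-realization-of-wild-solutions perturbed-data-vanishing-viscosity shear-flow-ansatz parallel-two-and-a-half-dimensional-data vortex-sheet-data
- blocks: the perturbed-data ("viscosity solution" [cite: BardosEtAl2013, §4]) form of block (i) of `BardosTitiWiedemann2012_thm5` for the data actually used there — Székelyhidi's flat vortex sheet `v₀ = (sgn x₂, 0, 0)` (`M = 2/π`) and every parallel shear datum `(v₁(x₂),0,0)` with `|k₂||v̂₁(k₂)| ≤ M`: realising any of the infinitely many non-shear admissible Euler solutions with that datum [cite: BardosTitiWiedemann2012, Cor. 2] [cite: Szekelyhidi2011, Thm. 1.1] as a weak-* limit of Leray–Hopf solutions whose data satisfy `‖u₀ʲ - v₀‖₂² exp(4M√(πT/ν_j)) → 0` is impossible — all such families select the steady shear flow; this extends the reach of `BardosTitiWiedemann2012_thm5_perturbedData`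 from the modulus `exp(-c/ν²)` to `exp(-c/√ν)` on this class.
- because: Serrin's relative energy inequality for a Leray–Hopf `u` against the heat-flow shear `U = (e^{νt∂₂²}v₁,0,0)` (an `x₃`-independent Leray–Hopf solution with the same datum, `shearField_third_ae_eq_zero`), with the trilinear term bounded pointwise by the `ℓ¹`-Fourier Lipschitz budget of `U(s)`, `∑_k 2π|k|₁|Û(k,s)| ≤ 2πM∑_{k₂≠0}e^{-4π²νsk₂²} ≤ M√(π/(νs))` (`sum_budget_shearHeat_le`), an `L¹(0,T)` function of integral `2M√(πT/ν)` (`lintegral_budget_eq`); Grönwall (`lintegral_enorm_sub_sq_le_mul_exp_of_budget`) gives `‖u(t)-U(t)‖₂² ≤ ‖u₀-v₀‖₂² exp(4M√(πt/ν))`, and `U ⇀* v₀` [cite: BardosTitiWiedemann2012, Thm. 5].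
- evasions_known: none inside the hypothesis. The exponent is sharp for the method: `exp(∫₀ᵀ‖∇U‖_∞) = exp(Θ(√(T/ν)))` is also the linear Kelvin–Helmholtz amplification of the diffusing layer of width `√(νt)` (growth rate `~1/√(νt)`), so above this theorem — data at distance `exp(-o(√(T/ν)))` from the sheet, in particular algebraic `ν^a` or `O(ν)`-energy perturbations — nothing is proved either way; there the computed inviscid limit is a spontaneously stochastic turbulent mixing layer of linearly growing width [cite: ThalabardBecMailybaev2020] whose uniform-in-Reynolds bounds are saturated by Székelyhidi's subsolution [cite: KalininMenonWu2024, Thm. 1 and Rem. 1–2], and the only rigorous non-selection by vanishing viscosity with vanishing perturbations is the forced radial scenario with its sharp algebraic threshold `ν^{κ_c}` [cite: AlbrittonColomboMescolini2025, Thm. 1.1]; a rigorous instability of shear LAYERS of width `√ν` under `ν^N` perturbations is classical (Grenier 2000) but is an `L^∞`, not an `L²`/weak-*, statement and starts from a pre-diffused layer.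
- scope_caveats: `T³`, unforced, finite window, house Leray–Hopf class `Torus.IsLerayHopfOn`; datum exactly `(v₁(x₂),0,0)` — the third component `v₃` of [cite: BardosTitiWiedemann2012, Thm. 5] is taken `0` (for Lipschitz `v₃` the same budget argument gives an exponent of the same order `T^{3/2}‖∇v₃‖_∞M/√ν`, not formalised; for `v₃ ∈ L²` only, the `exp(-c/ν²)` modulus of `BardosTitiWiedemann2012_thm5_perturbedData` is all that is proved); the coefficient hypothesis is on the `T³`-coefficients of `x ↦ v₁(x₂)` (those of `v₁` on the `k₂`-axis, zero elsewhere); weak-* convergence only is asserted, although the proof gives `sup_{t≤T}‖u_j(t)-U_j(t)‖₂ → 0`, hence strong convergence and no anomalous dissipation along the perturbed family as well (from the exact-datum case); constants: `4M√(πT/ν)` = twice the budget integral (the symmetrised bound `TV(v₁)√(T/(πν))` is not pursued).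
- status: established (theorem; proved in this file) [cite: BardosTitiWiedemann2012, Thm. 5] [cite: BardosEtAl2013, Thm. 3.1 and §4] -/
theorem BardosTitiWiedemann2012_thm5_perturbedData_sheet
    (v₁ : UnitAddCircle → ℝ) (hv₁ : MemLp v₁ 2 volume) {M : ℝ}
    (hM : ∀ k : Fin 3 → ℤ, |(k 1 : ℝ)| * ‖mFourierCoeff (fun x : UnitAddTorus (Fin 3) => ((v₁ (x 1) : ℝ) : ℂ)) k‖ ≤ M)
    {T : ℝ} (hT : 0 < T) (ν : ℕ → ℝ) (hν : ∀ j, 0 < ν j)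
    (hν₀ : Tendsto ν atTop (𝓝 0)) (u₀ : ℕ → UnitAddTorus (Fin 3) → EuclideanSpace ℝ (Fin 3)) (hu₀ : ∀ j, MemLp (u₀ j) 2 volume)
    (u : ℕ → ℝ → UnitAddTorus (Fin 3) → EuclideanSpace ℝ (Fin 3)) (hu : ∀ j, Torus.IsLerayHopfOn T (ν j) 0 (u₀ j) (u j))
    (hclose : Tendsto (fun j => (∫ x, ‖u₀ j x - shearData v₁ 0 x‖ ^ 2) *
        Real.exp (4 * M * Real.sqrt (Real.pi * T / ν j))) atTop (𝓝 0)) :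
    Torus.TendstoWeakStar u (shearFlow v₁ 0) T := by
  have hv₃ : MemLp (0 : UnitAddTorus (Fin 2) → ℝ) 2 volume := MemLp.zero
  set v₀ : UnitAddTorus (Fin 3) → EuclideanSpace ℝ (Fin 3) := shearData v₁ 0 with hv₀
  have hv₀m : MemLp v₀ 2 volume := memLp_shearData hv₁ hv₃
  have hM0 : 0 ≤ M := by
    have h := hM (fun i => if i = 1 then 1 else 0)
    simp only [if_true, Int.cast_one, abs_one, one_mul] at h
    exact (norm_nonneg _).trans h
  -- ### the exact-datum shear Leray–Hopf family and Thm. 5 (iii) for it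
  choose a c hU using fun j => BardosTitiWiedemann2012_thm5_shearLerayHopf_global v₁ hv₁ 0 hv₃ (hν j)
  set U : ℕ → ℝ → UnitAddTorus (Fin 3) → EuclideanSpace ℝ (Fin 3) := fun j => shearField (a j) (c j) with hUdef
  have hUT : ∀ j, Torus.IsLerayHopfOn T (ν j) 0 v₀ (U j) := fun j => hU j T hT
  have hUinv : ∀ j (t : ℝ) (s : UnitAddCircle) (x : UnitAddTorus (Fin 3)), U j t (x + Pi.single (2 : Fin 3) s) = U j t x := by
    intro j t s x; simp [hUdef, shearField]
  have h5 : Torus.TendstoWeakStar U (shearFlow v₁ 0) T :=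
    (BardosTitiWiedemann2012_thm5_holds v₁ hv₁ 0 hv₃ T hT).2 ν hν hν₀ U hUT
  -- ### the stability moduli `δ j`
  set δ : ℕ → ℝ := fun j => (∫ x, ‖u₀ j x - v₀ x‖ ^ 2) * Real.exp (4 * M * Real.sqrt (Real.pi * T / ν j)) with hδ
  have hδlim : Tendsto δ atTop (𝓝 0) := hclose
  have hexp1 : ∀ j, 1 ≤ Real.exp (4 * M * Real.sqrt (Real.pi * T / ν j)) :=
    fun j => Real.one_le_exp (by positivity)
  have hstab : ∀ j, ∀ t ∈ Ioc 0 T, ∫ x, ‖u j t x - U j t x‖ ^ 2 ≤ δ j := by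
    intro j t ht
    have ht' : t ∈ Icc 0 T := ⟨ht.1.le, ht.2⟩
    -- the budget of `U j` and its time integral
    have hb : ∀ s ∈ Ioo 0 T, ∀ F : Finset (Fin 3 → ℤ), ∑ k ∈ F, (2 * Real.pi * ∑ i, |(k i : ℝ)|) *
        ‖mFourierCoeff (EuclideanSpace.complexify ∘ U j s) k‖ ≤ M * Real.sqrt (Real.pi / (ν j * s)) :=
      fun s hs F => sum_budget_shearHeat_le hv₁ hM hT (hν j) (hUT j) hs F
    have hbint : ∫⁻ s in Ioo 0 T, ENNReal.ofReal (M * Real.sqrt (Real.pi / (ν j * s))) ≠ ⊤ := by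
      rw [lintegral_budget_eq hM0 (hν j) hT.le]; exact ENNReal.ofReal_ne_top
    have hG := lintegral_enorm_sub_sq_le_mul_exp_of_budget (hu j) (hUT j) (hν j).le hT (hu₀ j) hv₀m (hUinv j) hb hbint t ht
    -- the Grönwall exponent
    have hker : (∫⁻ s in Ioo 0 t, 2 * ENNReal.ofReal (M * Real.sqrt (Real.pi / (ν j * s)))).toReal ≤
        4 * M * Real.sqrt (Real.pi * T / ν j) := by
      rw [lintegral_const_mul' _ _ ENNReal.ofNat_ne_top, lintegral_budget_eq hM0 (hν j) ht.1.le, ENNReal.toReal_mul,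
        ENNReal.toReal_ofNat, ENNReal.toReal_ofReal (by positivity)]
      have : Real.sqrt (Real.pi * t / ν j) ≤ Real.sqrt (Real.pi * T / ν j) :=
        Real.sqrt_le_sqrt (div_le_div_of_nonneg_right (mul_le_mul_of_nonneg_left ht.2 Real.pi_pos.le) (hν j).le)
      nlinarith
    -- to real numbers
    have hwt : MemLp (fun x => u j t x - U j t x) 2 volume := ((hu j).memLp t ht').sub ((hUT j).memLp t ht')
    have hw0 : MemLp (fun x => u₀ j x - v₀ x) 2 volume := (hu₀ j).sub hv₀m
    rw [Torus.lintegral_enorm_sq_eq_ofReal hwt, Torus.lintegral_enorm_sq_eq_ofReal hw0,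
      ← ENNReal.ofReal_mul (integral_nonneg fun _ => sq_nonneg _)] at hG
    have hG' := (ENNReal.ofReal_le_ofReal_iff (mul_nonneg (integral_nonneg fun _ => sq_nonneg _)
      (Real.exp_pos _).le)).1 hG
    refine hG'.trans ?_
    simp only [hδ]
    exact mul_le_mul_of_nonneg_left (Real.exp_le_exp.2 hker) (integral_nonneg fun _ => sq_nonneg _)
  obtain ⟨D, hD⟩ : ∃ D : ℝ, ∀ j, δ j ≤ D := by
    obtain ⟨D, hD⟩ := hδlim.bddAbove_range
    exact ⟨D, fun j => hD ⟨j, rfl⟩⟩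
  have hdat : ∀ j, ∫ x, ‖u₀ j x - v₀ x‖ ^ 2 ≤ D := fun j =>
    (le_mul_of_one_le_right (integral_nonneg fun _ => sq_nonneg _) (hexp1 j)).trans (hD j)
  refine ⟨?_, fun ψ hψ => ?_⟩
  · -- ### uniform `L^∞_t L²_x` bound
    set Ce : ℝ≥0∞ := 2 * ENNReal.ofReal D + 2 * ∫⁻ x, ‖v₀ x‖ₑ ^ 2 with hCe
    have hv₀fin : ∫⁻ x, ‖v₀ x‖ₑ ^ 2 ≠ ⊤ := by
      rw [Torus.lintegral_enorm_sq_eq_ofReal hv₀m]; exact ENNReal.ofReal_ne_top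
    have hCetop : Ce ≠ ⊤ := ENNReal.add_ne_top.2 ⟨ENNReal.mul_ne_top ENNReal.ofNat_ne_top ENNReal.ofReal_ne_top,
      ENNReal.mul_ne_top ENNReal.ofNat_ne_top hv₀fin⟩
    refine ⟨Ce.toNNReal, fun m => ?_⟩
    rw [ENNReal.coe_toNNReal hCetop]
    filter_upwards [ae_restrict_mem measurableSet_Ioo] with t ht
    have ht' : t ∈ Icc 0 T := Ioo_subset_Icc_self ht
    have hmeas : AEMeasurable (fun x => ‖u₀ m x - v₀ x‖ₑ ^ 2) volume :=
      ((hu₀ m).sub hv₀m).aestronglyMeasurable.enorm.pow_const _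
    calc ∫⁻ x, ‖u m t x‖ₑ ^ 2 ≤ ∫⁻ x, ‖u₀ m x‖ₑ ^ 2 :=
          lintegral_enorm_sq_le_of_isLerayHopfOn (hν m).le (hu m) (hu₀ m) ht'
      _ ≤ ∫⁻ x, (2 * ‖u₀ m x - v₀ x‖ₑ ^ 2 + 2 * ‖v₀ x‖ₑ ^ 2) := lintegral_mono fun x => enorm_sq_le_two_mul_add _ _
      _ = 2 * (∫⁻ x, ‖u₀ m x - v₀ x‖ₑ ^ 2) + 2 * ∫⁻ x, ‖v₀ x‖ₑ ^ 2 := by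
          rw [lintegral_add_left' (hmeas.const_mul _), lintegral_const_mul' _ _ ENNReal.ofNat_ne_top,
            lintegral_const_mul' _ _ ENNReal.ofNat_ne_top]
      _ ≤ Ce := by
          rw [hCe]
          gcongr
          have h := Torus.lintegral_enorm_sq_eq_ofReal ((hu₀ m).sub hv₀m)
          simp only [Pi.sub_apply] at h
          rw [h]
          exact ENNReal.ofReal_le_ofReal (hdat m)
  · -- ### convergence against a test field
    obtain ⟨M, hM0, hM⟩ := exists_norm_le_of_isSpaceTimeTest hψ.1
    have hconvU := h5.2 ψ hψ
    have hvol : volume.real (Ioo (0 : ℝ) T) = T := by rw [Real.volume_real_Ioo_of_le hT.le, sub_zero]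
    have hbound : ∀ j, ‖(∫ t in Ioo 0 T, ∫ x, ⟪u j t x, ψ t x⟫_ℝ) - ∫ t in Ioo 0 T, ∫ x, ⟪U j t x, ψ t x⟫_ℝ‖ ≤
        M * Real.sqrt (δ j) * T := by
      intro j
      rw [← integral_sub (integrableOn_integral_inner_test (hu j) (hν j).le hψ.1)
        (integrableOn_integral_inner_test (hUT j) (hν j).le hψ.1)]
      calc ‖∫ t in Ioo 0 T, ((∫ x, ⟪u j t x, ψ t x⟫_ℝ) - ∫ x, ⟪U j t x, ψ t x⟫_ℝ)‖
          ≤ (M * Real.sqrt (δ j)) * volume.real (Ioo (0 : ℝ) T) := by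
            refine norm_setIntegral_le_of_norm_le_const measure_Ioo_lt_top fun t ht => ?_
            have ht' : t ∈ Icc 0 T := Ioo_subset_Icc_self ht
            have hut : MemLp (u j t) 2 volume := (hu j).memLp t ht'
            have hUt : MemLp (U j t) 2 volume := (hUT j).memLp t ht'
            have hψc : Continuous (ψ t) := (hψ.1.isSmooth_slice t).continuous
            rw [← integral_sub (integrable_inner_of_memLp_of_continuous hut hψc (hM t ht'))
              (integrable_inner_of_memLp_of_continuous hUt hψc (hM t ht'))]
            simp_rw [← inner_sub_left]
            calc ‖∫ x, ⟪u j t x - U j t x, ψ t x⟫_ℝ‖ ≤ M * Real.sqrt (∫ x, ‖u j t x - U j t x‖ ^ 2) :=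
                  norm_integral_inner_le_mul_sqrt (hut.sub hUt) (hM t ht')
              _ ≤ M * Real.sqrt (δ j) :=
                  mul_le_mul_of_nonneg_left (Real.sqrt_le_sqrt (hstab j t ⟨ht.1, ht.2.le⟩)) hM0
        _ = M * Real.sqrt (δ j) * T := by rw [hvol]
    have hlim0 : Tendsto (fun j => M * Real.sqrt (δ j) * T) atTop (𝓝 0) := by
      have h1 : Tendsto (fun j => Real.sqrt (δ j)) atTop (𝓝 0) := by
        have := (Real.continuous_sqrt.tendsto 0).comp hδlim
        rwa [Real.sqrt_zero] at this
      simpa using (h1.const_mul M).mul_const T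
    have hdiff := squeeze_zero_norm hbound hlim0
    have := hconvU.add hdiff
    rw [add_zero] at this
    refine this.congr fun j => ?_
    ring


end Literature.Barriers.AnomalousDissipation

end
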